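import Mathlib
import Literature.NumberTheory.Sieve.ShnirelmanGoldbachHarmonic
import Literature.NumberTheory.LFunctions.ChebyshevCostaPereira
import Literature.NumberTheory.LFunctions.ChebyshevCostaPereira68
import HarnessLib

/-!
# An explicit Shnirel'man–Goldbach theorem, continued (VIII): `39` primes unconditionally (`41` → `39`; the Rosser–Schoenfeld (3.3) column, `39`, equalled without hypothesis)

Topic `Literature/NumberTheory/Sieve`; namespace `Literature.NumberTheory.Sieve.ShnirelmanGoldbachExplicit` (continued —
this is §28 of the story of `ShnirelmanGoldbachExplicit.lean` (§1–§12), `ShnirelmanGoldbachFlatten.lean` (§13–§15),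
`ShnirelmanGoldbachBonferroni.lean` (§16–§19), `ShnirelmanGoldbachShifts.lean` (§20–§21), `ShnirelmanGoldbachCells.lean` (§22),
`ShnirelmanGoldbachThree.lean` (§23–§24), `ShnirelmanGoldbachGap.lean` (§25) and `ShnirelmanGoldbachHarmonic.lean` (§26–§27),
kept in its own module for the gate's size and elaboration caps).  Cell `parity-ideate` seat p5 g21, ROUND-44 «CP-m»
(`round44/SchnirelmannCP39.lean` sha16 09eec27c992e4c0d: its §D.5, §E–§F and three lemmas), landed with statements and proofs
verbatim (helpers `private`; verbatim `private` copies of the earlier modules' private helpers, as in the source).  The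
Chebyshev-side input — the `m = 68` Costa-Pereira-type scheme of p5 ROUND-44, PROVED in
`Literature/NumberTheory/LFunctions/ChebyshevCostaPereira68.lean` (four modules `…68Scheme`, `…68KernelA/B`, main):
`π(n) ≥ 0.98133 n/log n` for `n ≥ 227·30000³`, `≥ 0.982815 n/log n` for `n ≥ 227·30000⁴`, `≥ 0.984437 n/log n` for
`n ≥ 227·30000⁹` — replaces Costa Pereira's `m = 17` constant `0.9636` (§27) on the COUNT side, regime by regime; the
sieve side (`TwoResidueSelbergSumExplicit` §11, Harmonic §26) is unchanged.  No named facts, no definitions, no instances,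
no notation.

## References
* [Nathanson1996] M. B. Nathanson, *Additive Number Theory: The Classical Bases*, GTM 164 (1996), §7.3, Theorems 7.8–7.9.
* [BatemanDiamond2004] P. T. Bateman, H. G. Diamond, *Analytic Number Theory: An Introductory Course* (2004), §13.4
  (13.13)–(13.14), Lemma 13.11, Theorem 13.8.
* [CostaPereira1989] N. Costa Pereira, *Elementary estimates for the Chebyshev function ψ(x) and for the Möbius function
  M(x)*, Acta Arith. 52 (1989) 307–337, §2 (2.41) (the `m = 17` scheme; §27's count input, via `ChebyshevCostaPereira.lean`)
  and §§1–2 (the method behind the `m = 68` scheme of `ChebyshevCostaPereira68*.lean`, §28's count input).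
* [RosserSchoenfeld1962] J. B. Rosser, L. Schoenfeld, *Approximate formulas for some functions of prime numbers*,
  Illinois J. Math. 6 (1962), Theorem 2, eq. (3.3) (the conditional column's input, unchanged here).

## Content

* §28 (ROUND-44 «CP-m»): ONE input varied relative to §27 (`ShnirelmanGoldbachHarmonic.lean`) — the Chebyshev scheme again: Costa Pereira's `m = 17`
  (`0.9636`, ceiling `0.965`) ↦ the `m = 68` Costa-Pereira-type scheme of `ChebyshevCostaPereira68.lean` (PROVED there:
  `π(n) ≥ 0.98133 n/log n` for `n ≥ 227·30000³`, `0.982815` for `n ≥ 227·30000⁴`, `0.984437` for `n ≥ 227·30000⁹`), used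
  PER REGIME on the count side only: `primeCountingLowerMul_0984437`, the first moment `c₁ = 0.4845`
  (`sum_goldbachCount_ge_04845`), the pair sieve re-derived from `e^{37.29}` with the kappa4 step from `Λ ≥ 37`
  (`explicit_of_largeSieve_kappa4_c37`, `pairCount_le_of_numeric4_c37`, `pairCount_le_1305`), the Goldbach sieve `11.35`
  from `e^{297}` (`goldbachCount_le_1135`), the five-regime glue with `h ≥ 19` and one-shift reach `1.96266·h ≥ 37.29`
  (`half_count_ge_allN_cp37`), the count `x/38` above `e^{313}` (`goldbach_even_count_ge_38_exp313`), `σ(B) ≥ 1/19`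
  (`half_count_ge_allN_19`, `schnirelmannDensity_half_ge_19`) and **`schnirelmann_goldbach_le_39`** (Mann: `2·19 + 1`):
  unconditionally every `N ≥ 2` is a sum of at most `39` primes — the unconditional constant of this elementary
  architecture now EQUALS the Rosser–Schoenfeld column (§25); p5 ROUND-44 §9 records `K = 37` as the architecture's wall.

Table of the series (K unconditional / under Rosser–Schoenfeld (3.3)): … → §22 47/43 → §23–§24 45/41 → §25 45/39 → §26 43/39
→ §27 41/39 → §28 39/39.  Print calibration (NOT formalised, not used): Klimov 1975 (`55`), Vaughan 1977 (`27`), Deshouillers 1977 (`26`),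
Riesel–Vaughan 1983 (`19`), Ramaré 1995 (even `n`: `≤ 6` primes), Helfgott 2013 (`K ≤ 4`).
-/

namespace Literature.NumberTheory.Sieve.ShnirelmanGoldbachExplicit

open Finset Real
open scoped Classical Pointwise
open Literature.NumberTheory.Sieve Literature.Combinatorics.Additive
open Literature.NumberTheory.Sieve.GoldbachSieveEight (ft Qsum sum_ft_le_Qsum)
open Literature.NumberTheory.Sieve.TwoResidueSelbergExplicit (kappaSet2 TlowK2 sum_ft_ge_kappa2 Qsum_ge_kappa2
  kappaSet3 TlowK3 sum_ft_ge_kappa3 Qsum_ge_kappa3 TlowK4 sum_ft_ge_kappa4 Qsum_ge_kappa4)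
open Literature.NumberTheory.Sieve.GoldbachLinnik (oddSingularFactor oddSingularFactor_nonneg)
open Literature.NumberTheory.Sieve.RomanoffExplicit (PrimeCountingLowerMul primeCountingLowerMul_09212
  primeCounting_ge_div45)


/-! ### Private copies (verbatim) of helpers of §1–§27 used in §28 (private in their tree modules) -/

/-- `TlowK4` is increasing on `[0, ∞)` (`TlowK4 l − TlowK4 l₁ = (l − l₁)(0.3658(l + l₁) + 0.3394)`). [folklore] -/
private theorem TlowK4_mono {l₁ l : ℝ} (h₁ : 0 ≤ l₁) (h : l₁ ≤ l) : TlowK4 l₁ ≤ TlowK4 l := by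
  unfold TlowK4
  have h2 : (0 : ℝ) ≤ 0.3658 * (l + l₁) + 0.3394 := by nlinarith
  nlinarith [mul_nonneg (sub_nonneg.2 h) h2]

/-- The halving map: `#{even N ∈ (0, 2y] : N = p + q} ≤ #{b ∈ (0, y] : b ∈ B}`, `B = {0, 1} ∪ {m : 2m = p + q}`
(`N ↦ N/2`). [folklore] -/
private theorem even_goldbach_card_le_half (y : ℕ) :
    #{N ∈ Ioc 0 (2 * y) | Even N ∧ ∃ p q : ℕ, p.Prime ∧ q.Prime ∧ p + q = N}
      ≤ #{b ∈ Ioc 0 y | b ∈ (({0, 1} : Set ℕ) ∪ {m | ∃ p q : ℕ, p.Prime ∧ q.Prime ∧ p + q = 2 * m})} := by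
  refine card_le_card_of_injOn (fun N => N / 2) ?_ ?_
  · intro N hN
    rw [mem_coe, mem_filter, mem_Ioc] at hN
    obtain ⟨⟨hN0, hNy⟩, ⟨k, hk⟩, p, q, hp, hq, hpq⟩ := hN
    rw [mem_coe, mem_filter, mem_Ioc]
    dsimp only
    exact ⟨⟨by omega, by omega⟩, Or.inr ⟨p, q, hp, hq, by omega⟩⟩
  · intro N hN N' hN' h
    rw [mem_coe, mem_filter] at hN hN'
    obtain ⟨k, hk⟩ := hN.2.1
    obtain ⟨k', hk'⟩ := hN'.2.1
    simp only at h
    omega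

/-- `σ(S) ≥ 1/K` from `S(N) ≥ N/K` (`N ≥ 1`), for any set `S`. [folklore] -/
private theorem schnirelmannDensity_ge_of_count' {S : Set ℕ} [DecidablePred (· ∈ S)] {K : ℕ}
    (h : ∀ N : ℕ, 1 ≤ N → (N : ℝ) / K ≤ #{a ∈ Ioc 0 N | a ∈ S}) :
    (1 : ℝ) / K ≤ schnirelmannDensity S := by
  rw [le_schnirelmannDensity_iff]
  intro n hn
  have hn' : (0 : ℝ) < n := by exact_mod_cast hn
  rw [le_div_iff₀ hn']
  have := h n hn
  calc (1 : ℝ) / K * n = (n : ℝ) / K := by ring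
    _ ≤ _ := by convert this using 2

/-- `f(n) ≥ 1`. [folklore] -/
private theorem one_le_oddSingularFactor' (n : ℕ) : 1 ≤ oddSingularFactor n := by
  unfold oddSingularFactor
  have h : ∏ _p ∈ n.primeFactors.filter (2 < ·), (1 : ℝ)
      ≤ ∏ p ∈ n.primeFactors.filter (2 < ·), (((p : ℝ) - 1) / ((p : ℝ) - 2)) := by
    refine Finset.prod_le_prod (fun _ _ => zero_le_one) fun p hp => ?_
    rw [Finset.mem_filter] at hp
    have hp3 : (3 : ℝ) ≤ p := by exact_mod_cast hp.2
    rw [le_div_iff₀ (by linarith)]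
    linarith
  simpa using h

/-- `((2y − 3 : ℕ) : ℝ) = 2y − 3` for `y ≥ 2`. [folklore] -/
private theorem cast_two_mul_sub_three {y : ℕ} (hy : 2 ≤ y) : ((2 * y - 3 : ℕ) : ℝ) = 2 * (y : ℝ) - 3 := by
  have h3y : 3 ≤ 2 * y := by omega
  rw [Nat.cast_sub h3y]
  push_cast
  ring

/-- `log n ≤ 14` for `n < 10⁶` (`10⁶ ≤ 2.7¹⁴ ≤ e¹⁴`). [folklore] -/
private theorem log_le_14_of_lt {n : ℕ} (hn0 : 0 < n) (h6 : n < 10 ^ 6) : Real.log (n : ℝ) ≤ 14 := by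
  have hn0' : (0 : ℝ) < n := by exact_mod_cast hn0
  have hy6 : (n : ℝ) ≤ (2.7 : ℝ) ^ 14 := by
    have : (n : ℝ) < 10 ^ 6 := by exact_mod_cast h6
    have h27 : (10 : ℝ) ^ 6 ≤ (2.7 : ℝ) ^ 14 := by norm_num
    linarith
  have he : (2.7 : ℝ) ≤ Real.exp 1 := by have := Real.exp_one_gt_d9; linarith
  have h14 : (2.7 : ℝ) ^ 14 ≤ Real.exp 14 := by
    rw [show (14 : ℝ) = ((14 : ℕ) : ℝ) * 1 by norm_num, Real.exp_nat_mul]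
    exact pow_le_pow_left₀ (by norm_num) he 14
  have := Real.log_le_log hn0' (hy6.trans h14)
  rwa [Real.log_exp] at this

/-- `((2y − q : ℕ) : ℝ) = 2y − q` for `q ≤ 2y`. [folklore] -/
private theorem cast_two_mul_sub {y q : ℕ} (h : q ≤ 2 * y) : ((2 * y - q : ℕ) : ℝ) = 2 * (y : ℝ) - q := by
  rw [Nat.cast_sub h]
  push_cast
  ring

/-- `f(2) = 1`. [folklore] -/
private theorem oddSingularFactor_two' : oddSingularFactor 2 = 1 := by
  rw [show (2 : ℕ) = 2 ^ 1 * 1 by norm_num, GoldbachLinnik.oddSingularFactor_two_pow_mul 1 one_ne_zero,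
    GoldbachLinnik.oddSingularFactor_one]

/-- `f(4) = 1`. [folklore] -/
private theorem oddSingularFactor_four : oddSingularFactor 4 = 1 := by
  rw [show (4 : ℕ) = 2 ^ 2 * 1 by norm_num, GoldbachLinnik.oddSingularFactor_two_pow_mul 2 one_ne_zero,
    GoldbachLinnik.oddSingularFactor_one]

/-- `f(8) = 1`. [folklore] -/
private theorem oddSingularFactor_eight : oddSingularFactor 8 = 1 := by
  rw [show (8 : ℕ) = 2 ^ 3 * 1 by norm_num, GoldbachLinnik.oddSingularFactor_two_pow_mul 3 one_ne_zero,
    GoldbachLinnik.oddSingularFactor_one]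

/-- `f(6) = 2` (the factor `(3−1)/(3−2)`). [folklore] -/
private theorem oddSingularFactor_six : oddSingularFactor 6 = 2 := by
  rw [show (6 : ℕ) = 2 ^ 1 * 3 by norm_num, GoldbachLinnik.oddSingularFactor_two_pow_mul 1 (by norm_num)]
  show ∏ p ∈ (Nat.primeFactors 3).filter (2 < ·), (((p : ℝ) - 1) / ((p : ℝ) - 2)) = 2
  rw [Nat.prime_three.primeFactors, Finset.filter_singleton, if_pos (by norm_num), Finset.prod_singleton]
  norm_num

/-- `f(10) = 4/3`. [folklore] -/
private theorem oddSingularFactor_ten : oddSingularFactor 10 = 4 / 3 := by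
  rw [show (10 : ℕ) = 2 ^ 1 * 5 by norm_num, GoldbachLinnik.oddSingularFactor_two_pow_mul 1 (by norm_num)]
  show ∏ p ∈ (Nat.primeFactors 5).filter (2 < ·), (((p : ℝ) - 1) / ((p : ℝ) - 2)) = 4 / 3
  rw [Nat.prime_five.primeFactors, Finset.filter_singleton, if_pos (by norm_num), Finset.prod_singleton]
  norm_num

/-- `f(12) = 2`. [folklore] -/
private theorem oddSingularFactor_twelve : oddSingularFactor 12 = 2 := by
  rw [show (12 : ℕ) = 2 ^ 2 * 3 by norm_num, GoldbachLinnik.oddSingularFactor_two_pow_mul 2 (by norm_num)]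
  show ∏ p ∈ (Nat.primeFactors 3).filter (2 < ·), (((p : ℝ) - 1) / ((p : ℝ) - 2)) = 2
  rw [Nat.prime_three.primeFactors, Finset.filter_singleton, if_pos (by norm_num), Finset.prod_singleton]
  norm_num

/-- `f(14) = 6/5`. [folklore] -/
private theorem oddSingularFactor_fourteen : oddSingularFactor 14 = 6 / 5 := by
  rw [show (14 : ℕ) = 2 ^ 1 * 7 by norm_num, GoldbachLinnik.oddSingularFactor_two_pow_mul 1 (by norm_num)]
  show ∏ p ∈ (Nat.primeFactors 7).filter (2 < ·), (((p : ℝ) - 1) / ((p : ℝ) - 2)) = 6 / 5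
  rw [(by norm_num : Nat.Prime 7).primeFactors, Finset.filter_singleton, if_pos (by norm_num), Finset.prod_singleton]
  norm_num

/-- `f(16) = 1`. [folklore] -/
private theorem oddSingularFactor_sixteen : oddSingularFactor 16 = 1 := by
  rw [show (16 : ℕ) = 2 ^ 4 * 1 by norm_num, GoldbachLinnik.oddSingularFactor_two_pow_mul 4 one_ne_zero,
    GoldbachLinnik.oddSingularFactor_one]

/-- `f(18) = 2`. [folklore] -/
private theorem oddSingularFactor_eighteen : oddSingularFactor 18 = 2 := by
  rw [show (18 : ℕ) = 2 ^ 1 * 9 by norm_num, GoldbachLinnik.oddSingularFactor_two_pow_mul 1 (by norm_num)]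
  show ∏ p ∈ (Nat.primeFactors 9).filter (2 < ·), (((p : ℝ) - 1) / ((p : ℝ) - 2)) = 2
  rw [show (9 : ℕ) = 3 ^ 2 by norm_num, Nat.primeFactors_prime_pow (by norm_num) Nat.prime_three,
    Finset.filter_singleton, if_pos (by norm_num), Finset.prod_singleton]
  norm_num

/-- `f(20) = 4 / 3`. [folklore] -/
private theorem oddSingularFactor_twenty : oddSingularFactor 20 = 4 / 3 := by
  rw [show (20 : ℕ) = 2 ^ 2 * 5 by norm_num, GoldbachLinnik.oddSingularFactor_two_pow_mul 2 (by norm_num)]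
  show ∏ p ∈ (Nat.primeFactors 5).filter (2 < ·), (((p : ℝ) - 1) / ((p : ℝ) - 2)) = 4 / 3
  rw [Nat.prime_five.primeFactors, Finset.filter_singleton, if_pos (by norm_num), Finset.prod_singleton]
  norm_num

/-- `f(22) = 10 / 9`. [folklore] -/
private theorem oddSingularFactor_twentytwo : oddSingularFactor 22 = 10 / 9 := by
  rw [show (22 : ℕ) = 2 ^ 1 * 11 by norm_num, GoldbachLinnik.oddSingularFactor_two_pow_mul 1 (by norm_num)]
  show ∏ p ∈ (Nat.primeFactors 11).filter (2 < ·), (((p : ℝ) - 1) / ((p : ℝ) - 2)) = 10 / 9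
  rw [(by norm_num : Nat.Prime 11).primeFactors, Finset.filter_singleton, if_pos (by norm_num), Finset.prod_singleton]
  norm_num

/-- `f(24) = 2`. [folklore] -/
private theorem oddSingularFactor_twentyfour : oddSingularFactor 24 = 2 := by
  rw [show (24 : ℕ) = 2 ^ 3 * 3 by norm_num, GoldbachLinnik.oddSingularFactor_two_pow_mul 3 (by norm_num)]
  show ∏ p ∈ (Nat.primeFactors 3).filter (2 < ·), (((p : ℝ) - 1) / ((p : ℝ) - 2)) = 2
  rw [Nat.prime_three.primeFactors, Finset.filter_singleton, if_pos (by norm_num), Finset.prod_singleton]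
  norm_num

/-- `f(26) = 12 / 11`. [folklore] -/
private theorem oddSingularFactor_twentysix : oddSingularFactor 26 = 12 / 11 := by
  rw [show (26 : ℕ) = 2 ^ 1 * 13 by norm_num, GoldbachLinnik.oddSingularFactor_two_pow_mul 1 (by norm_num)]
  show ∏ p ∈ (Nat.primeFactors 13).filter (2 < ·), (((p : ℝ) - 1) / ((p : ℝ) - 2)) = 12 / 11
  rw [(by norm_num : Nat.Prime 13).primeFactors, Finset.filter_singleton, if_pos (by norm_num), Finset.prod_singleton]
  norm_num

/-- `f(28) = 6 / 5`. [folklore] -/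
private theorem oddSingularFactor_twentyeight : oddSingularFactor 28 = 6 / 5 := by
  rw [show (28 : ℕ) = 2 ^ 2 * 7 by norm_num, GoldbachLinnik.oddSingularFactor_two_pow_mul 2 (by norm_num)]
  show ∏ p ∈ (Nat.primeFactors 7).filter (2 < ·), (((p : ℝ) - 1) / ((p : ℝ) - 2)) = 6 / 5
  rw [(by norm_num : Nat.Prime 7).primeFactors, Finset.filter_singleton, if_pos (by norm_num), Finset.prod_singleton]
  norm_num

/-- `f(30) = 8 / 3`. [folklore] -/
private theorem oddSingularFactor_thirty : oddSingularFactor 30 = 8 / 3 := by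
  rw [show (30 : ℕ) = 2 ^ 1 * 15 by norm_num, GoldbachLinnik.oddSingularFactor_two_pow_mul 1 (by norm_num)]
  show ∏ p ∈ (Nat.primeFactors 15).filter (2 < ·), (((p : ℝ) - 1) / ((p : ℝ) - 2)) = 8 / 3
  rw [show (15 : ℕ) = 3 * 5 by norm_num, Nat.primeFactors_mul (by norm_num) (by norm_num),
    Nat.prime_three.primeFactors, Nat.prime_five.primeFactors, Finset.filter_union, Finset.filter_singleton,
    Finset.filter_singleton, if_pos (by norm_num), if_pos (by norm_num), Finset.prod_union (by simp),
    Finset.prod_singleton, Finset.prod_singleton]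
  norm_num

/-- `f(32) = 1`. [folklore] -/
private theorem oddSingularFactor_thirtytwo : oddSingularFactor 32 = 1 := by
  rw [show (32 : ℕ) = 2 ^ 5 * 1 by norm_num, GoldbachLinnik.oddSingularFactor_two_pow_mul 5 one_ne_zero,
    GoldbachLinnik.oddSingularFactor_one]

/-- `f(34) = 16 / 15`. [folklore] -/
private theorem oddSingularFactor_thirtyfour : oddSingularFactor 34 = 16 / 15 := by
  rw [show (34 : ℕ) = 2 ^ 1 * 17 by norm_num, GoldbachLinnik.oddSingularFactor_two_pow_mul 1 (by norm_num)]
  show ∏ p ∈ (Nat.primeFactors 17).filter (2 < ·), (((p : ℝ) - 1) / ((p : ℝ) - 2)) = 16 / 15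
  rw [(by norm_num : Nat.Prime 17).primeFactors, Finset.filter_singleton, if_pos (by norm_num), Finset.prod_singleton]
  norm_num

/-- `f(36) = 2`. [folklore] -/
private theorem oddSingularFactor_thirtysix : oddSingularFactor 36 = 2 := by
  rw [show (36 : ℕ) = 2 ^ 2 * 9 by norm_num, GoldbachLinnik.oddSingularFactor_two_pow_mul 2 (by norm_num)]
  show ∏ p ∈ (Nat.primeFactors 9).filter (2 < ·), (((p : ℝ) - 1) / ((p : ℝ) - 2)) = 2
  rw [show (9 : ℕ) = 3 ^ 2 by norm_num, Nat.primeFactors_prime_pow (by norm_num) Nat.prime_three,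
    Finset.filter_singleton, if_pos (by norm_num), Finset.prod_singleton]
  norm_num

/-- `f(38) = 18 / 17`. [folklore] -/
private theorem oddSingularFactor_thirtyeight : oddSingularFactor 38 = 18 / 17 := by
  rw [show (38 : ℕ) = 2 ^ 1 * 19 by norm_num, GoldbachLinnik.oddSingularFactor_two_pow_mul 1 (by norm_num)]
  show ∏ p ∈ (Nat.primeFactors 19).filter (2 < ·), (((p : ℝ) - 1) / ((p : ℝ) - 2)) = 18 / 17
  rw [(by norm_num : Nat.Prime 19).primeFactors, Finset.filter_singleton, if_pos (by norm_num), Finset.prod_singleton]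
  norm_num

/-- `e^{2.7728} ≥ 16.00192 = 16·1.00012` (`2.7728 = 4·0.6931471808 + 0.0002112768`). [folklore] -/
private theorem exp_27728_ge : (16.00192 : ℝ) ≤ Real.exp 2.7728 := by
  have hl2 : (2 : ℝ) ≤ Real.exp 0.6931471808 := by
    have h1 := Real.exp_log (show (0:ℝ) < 2 by norm_num)
    have h2 := Real.exp_le_exp.mpr Real.log_two_lt_d9.le
    linarith
  have hsmall : (1.0002112768 : ℝ) ≤ Real.exp 0.0002112768 := by
    have := Real.add_one_le_exp (0.0002112768 : ℝ); linarith
  have hprod : Real.exp (2.7728 : ℝ) = Real.exp 0.6931471808 ^ 4 * Real.exp 0.0002112768 := by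
    rw [← Real.exp_nat_mul, ← Real.exp_add]; norm_num
  rw [hprod]
  have h16 : (16 : ℝ) ≤ Real.exp 0.6931471808 ^ 4 := by
    have := pow_le_pow_left₀ (by norm_num : (0:ℝ) ≤ 2) hl2 4
    linarith [show ((2 : ℝ)) ^ 4 = 16 by norm_num]
  nlinarith [mul_le_mul h16 hsmall (by norm_num) (by positivity)]

set_option maxHeartbeats 1600000 in

/-- `e^{1.3865} ≥ 4.00048 = 4·1.00012` (`1.3865 = 2·0.6931471808 + 0.0002056384`). [folklore] -/
private theorem exp_13865_ge : (4.00048 : ℝ) ≤ Real.exp 1.3865 := by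
  have hl2 : (2 : ℝ) ≤ Real.exp 0.6931471808 := by
    have h1 := Real.exp_log (show (0:ℝ) < 2 by norm_num)
    have h2 := Real.exp_le_exp.mpr Real.log_two_lt_d9.le
    linarith
  have hsmall : (1.0002056384 : ℝ) ≤ Real.exp 0.0002056384 := by
    have := Real.add_one_le_exp (0.0002056384 : ℝ); linarith
  have hprod : Real.exp (1.3865 : ℝ) = Real.exp 0.6931471808 ^ 2 * Real.exp 0.0002056384 := by
    rw [← Real.exp_nat_mul, ← Real.exp_add]; norm_num
  rw [hprod]
  have h4 : (4 : ℝ) ≤ Real.exp 0.6931471808 ^ 2 := by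
    have := pow_le_pow_left₀ (by norm_num : (0:ℝ) ≤ 2) hl2 2
    linarith [show ((2 : ℝ)) ^ 2 = 4 by norm_num]
  nlinarith [mul_le_mul h4 hsmall (by norm_num) (by positivity)]


/-! ## §28 ROUND-44 «CP-m»: the Chebyshev scheme `m = 17` (`0.9636`) ↦ the `m = 68` scheme (`0.98133 / 0.982815 / 0.984437` per regime), read through §27 -/

/-! ### §28.0 The count input: `π(n) ≥ 0.984437·n/log n` (`n ≥ 227·30000⁹`) as `PrimeCountingLowerMul`, the first moment `0.4845` from `e^109` -/

/-- `10⁴⁷ ≤ e^{109}`. [folklore] -/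
private theorem ten_pow_47_le_exp_109 : (10 : ℝ) ^ 47 ≤ Real.exp 109 := by
  have he : (2.718281828 : ℝ) ≤ Real.exp 1 := by have := Real.exp_one_gt_d9; linarith
  have h := pow_le_pow_left₀ (by norm_num) he 109
  rw [← Real.exp_nat_mul] at h
  norm_num at h
  exact le_trans (by norm_num) h

/-- **`π(n) ≥ 0.984437·n/log n` for every `n ≥ 227·30000⁹`** (the `m = 68` scheme of `ChebyshevCostaPereira68.lean`, shot 9). [cite: CostaPereira1989, Theorem 2 (2.34) (method); the `m = 68` scheme and the constant `0.984437` for `n ≥ 227·30000⁹`: `ChebyshevCostaPereira68.lean`] -/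
theorem primeCountingLowerMul_0984437 : PrimeCountingLowerMul 0.984437 4468041000000000000000000000000000000000000 :=
  fun _ hn => Literature.NumberTheory.LFunctions.CostaPereira68.primeCounting_ge_9 hn

/-- **First moment, `0.4845`, from `e^109`** (`0.984437²/2 = 0.48456`; `x₁ = 227·30000⁹`). [cite: Nathanson1996, Theorem 7.8 (first moment of the Goldbach count; explicit constant `0.984437²/2` proved here)] -/
theorem sum_goldbachCount_ge_04845 {x : ℕ} (hx : Real.exp 109 ≤ (x : ℝ)) :
    0.4845 * ((x : ℝ) ^ 2 / Real.log x ^ 2) ≤ ∑ N ∈ range (x + 1), (SingularSeries.goldbachCount N : ℝ) := by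
  have hbig : (10 : ℝ) ^ 47 ≤ x := ten_pow_47_le_exp_109.trans hx
  have hx2 : 2 * 4468041000000000000000000000000000000000000 ≤ x := by
    have : ((2 * 4468041000000000000000000000000000000000000 : ℕ) : ℝ) ≤ x := by push_cast; linarith
    exact_mod_cast this
  have h := sum_goldbachCount_ge_of_lower (by norm_num) (by norm_num) primeCountingLowerMul_0984437 hx2
  refine le_trans ?_ h
  have hx1 : (1 : ℝ) < x := by linarith
  have hL : 0 < Real.log x := Real.log_pos hx1
  have hL2 : 0 < 2 * Real.log x ^ 2 := by positivity
  have hxn : (0 : ℝ) ≤ x := by linarith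
  have key : 0.4845 * (x : ℝ) ^ 2 * 2 ≤ 0.984437 ^ 2 * (((x : ℝ) - ((4468041000000000000000000000000000000000000 : ℕ) : ℝ)) ^ 2 - ((4468041000000000000000000000000000000000000 : ℕ) : ℝ) ^ 2) := by
    push_cast
    nlinarith [mul_le_mul_of_nonneg_right hbig hxn]
  calc 0.4845 * ((x : ℝ) ^ 2 / Real.log x ^ 2) = (0.4845 * (x : ℝ) ^ 2 * 2) / (2 * Real.log x ^ 2) := by
        field_simp
    _ ≤ 0.984437 ^ 2 * (((x : ℝ) - ((4468041000000000000000000000000000000000000 : ℕ) : ℝ)) ^ 2 - ((4468041000000000000000000000000000000000000 : ℕ) : ℝ) ^ 2) / (2 * Real.log x ^ 2) :=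
        div_le_div_of_nonneg_right key hL2.le
    _ = 0.984437 ^ 2 * ((((x : ℝ) - ((4468041000000000000000000000000000000000000 : ℕ) : ℝ)) ^ 2 - ((4468041000000000000000000000000000000000000 : ℕ) : ℝ) ^ 2) / (2 * Real.log x ^ 2)) := by ring

/-- `4.3·10¹⁵ ≤ e^{36}` (private copy of the Chebyshev module's numeric lemma). [folklore] -/
private theorem cp68_exp_36_ge : (4300000000000000 : ℝ) ≤ Real.exp 36 := by
  have h1 : Real.exp 36 = Real.exp 1 ^ 36 := by rw [← Real.exp_nat_mul]; norm_num
  have h2 := Real.exp_one_gt_d9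
  rw [h1]
  exact le_trans (by norm_num) (pow_le_pow_left₀ (by norm_num) h2.le 36)

/-! ### §28.1 (ROUND-44) The pair sieve from `e^{37.29}` (`c = 4`, kappa4 step from `Λ ≥ 37`), the Goldbach sieve `11.35`
from `e^{297}` -/

/-- `TlowK4 l ≥ 88` for `l ≥ 17.2` (the cell polynomial at the pair-sieve threshold `Λ/2 − 2.77 ≥ 17.2`). [folklore] -/
private theorem TlowK4_ge88' {l₁ : ℝ} (h₁ : 17.2 ≤ l₁) : 88 ≤ TlowK4 l₁ := by
  unfold TlowK4; nlinarith [h₁, sq_nonneg (l₁ - 17.2)]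

/-- Numeric / monotonicity bookkeeping for §28 (`numeral_le_exp_37`). [folklore] -/
private theorem numeral_le_exp_37 : (6130000000000000 : ℝ) ≤ Real.exp 37 := by
  have he : (2.718281828 : ℝ) ≤ Real.exp 1 := by have := Real.exp_one_gt_d9; linarith
  have h := pow_le_pow_left₀ (by norm_num) he 37
  rw [← Real.exp_nat_mul] at h
  norm_num at h
  exact le_trans (by norm_num) h

/-- Numeric / monotonicity bookkeeping for §28 (`numeral_le_exp_47`). [folklore] -/
private theorem numeral_le_exp_47 : (183880000000000000000 : ℝ) ≤ Real.exp 47 := by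
  have he : (2.718281828 : ℝ) ≤ Real.exp 1 := by have := Real.exp_one_gt_d9; linarith
  have h := pow_le_pow_left₀ (by norm_num) he 47
  rw [← Real.exp_nat_mul] at h
  norm_num at h
  exact le_trans (by norm_num) h

/-- Numeric / monotonicity bookkeeping for §28 (`numeral_le_exp_18`). [folklore] -/
private theorem numeral_le_exp_18 : (4600000 : ℝ) ≤ Real.exp 18 := by
  have he : (2.718281828 : ℝ) ≤ Real.exp 1 := by have := Real.exp_one_gt_d9; linarith
  have h := pow_le_pow_left₀ (by norm_num) he 18
  rw [← Real.exp_nat_mul] at h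
  norm_num at h
  exact le_trans (by norm_num) h

/-- `227·30000³ ≤ e^{36.4}`. [folklore] -/
private theorem X3_le_exp_364 : (6129000000000000 : ℝ) ≤ Real.exp 36.4 := by
  have h1 := cp68_exp_36_ge
  have h2 : (1.48 : ℝ) ≤ Real.exp 0.4 := by
    have := Real.quadratic_le_exp_of_nonneg (show (0 : ℝ) ≤ 0.4 by norm_num); norm_num at this; linarith
  have h3 : Real.exp 36.4 = Real.exp 36 * Real.exp 0.4 := by rw [← Real.exp_add]; norm_num
  rw [h3]; nlinarith [Real.exp_pos (36 : ℝ), Real.exp_pos (0.4 : ℝ)]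

/-- The boundary numerics from `L ≥ 37`: `(E/4 + 1)·L² ≤ 0.01·E²` once `100 L² ≤ E`. [folklore] -/
private theorem tail_numeric37 {L E : ℝ} (hL : 37 ≤ L) (hEL : 100 * L ^ 2 ≤ E) :
    (E / 4 + 1) * L ^ 2 ≤ 0.01 * E ^ 2 := by
  have hL2 : (1369 : ℝ) ≤ L ^ 2 := by nlinarith [hL]
  have hE : (136900 : ℝ) ≤ E := by linarith
  nlinarith [hEL, hE, hL2]

set_option maxHeartbeats 1600000 in
/-- **The enlarged-cell explicit large-sieve step from `e^37`** (ROUND-44; as `explicit_of_largeSieve_kappa4_c38` with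
`Λ ≥ max(37, 34.4 + 2·lc)` and `c ≤ 16`: `√N ≥ e^{18} ≥ 4.6·10^6 ≥ 16·262145` at `L ≥ 37`, `TlowK4(l₁) ≥ 88` for
`l₁ ≥ 17.2`, and the boundary numerics from `L ≥ 37`).
[cite: BatemanDiamond2004, Thm 13.8, §13.4–13.5 pp. 325–328 (explicit form proved here)] -/
theorem explicit_of_largeSieve_kappa4_c37 {c : ℕ} {lc Λ A : ℝ} (hc4 : 4 ≤ c) (hc16 : c ≤ 16)
    (hlc : (c : ℝ) * 1.00012 ≤ Real.exp lc) (hΛ : 37 ≤ Λ) (hΛc : 34.4 + 2 * lc ≤ Λ)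
    (hA : ∀ L : ℝ, Λ ≤ L → ((c : ℝ) ^ 2 + 1) * L ^ 2
        ≤ (c : ℝ) ^ 2 * (A - 0.02) * TlowK4 (L / 2 - lc))
    {N : ℕ} {C F B : ℝ} (hN : Real.exp Λ ≤ (N : ℝ)) (hF1 : 1 ≤ F)
    (hB : B ≤ 2 * ((Nat.sqrt N / c : ℕ) : ℝ) + 2)
    (hBD : C * GoldbachSieveEight.Qsum ∅ (Nat.sqrt N / c) ≤ (((Nat.sqrt N / c : ℕ) : ℝ) ^ 2 + N - 1) * F
      + B * GoldbachSieveEight.Qsum ∅ (Nat.sqrt N / c)) :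
    C ≤ A * F * (N : ℝ) / Real.log (N : ℝ) ^ 2 := by
  have hN0 : (0 : ℝ) < N := lt_of_lt_of_le (Real.exp_pos Λ) hN
  set L := Real.log (N : ℝ) with hLdef
  have hL : Λ ≤ L := by
    have := Real.log_le_log (Real.exp_pos Λ) hN
    rwa [Real.log_exp] at this
  have hL40 : (37 : ℝ) ≤ L := le_trans hΛ hL
  have hL2pos : 0 < L ^ 2 := by positivity
  have hcpos : 0 < c := by omega
  have hc0 : (0 : ℝ) < c := by exact_mod_cast hcpos
  have hcR4 : (4 : ℝ) ≤ c := by exact_mod_cast hc4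
  have hcR32 : (c : ℝ) ≤ 16 := by exact_mod_cast hc16
  -- E = √N = exp(L/2)
  set E := Real.exp (L / 2) with hEdef
  have hE0 : 0 < E := Real.exp_pos _
  have hE2 : E ^ 2 = N := by
    have : E ^ 2 = Real.exp L := by rw [hEdef, sq, ← Real.exp_add]; ring_nf
    rw [this, hLdef, Real.exp_log hN0]
  have hE8 : (L / 2) ^ 8 / 40320 ≤ E := by
    have := Real.pow_div_factorial_le_exp (L / 2) (by linarith) 8
    simpa [Nat.factorial] using this
  have hLsq : (1369 : ℝ) ≤ L ^ 2 := by nlinarith [hL40]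
  have hL4 : (1369 : ℝ) ^ 2 ≤ (L ^ 2) ^ 2 := pow_le_pow_left₀ (by norm_num) hLsq 2
  have hEL : 100 * L ^ 2 ≤ E := by
    have h1 : (1369 : ℝ) ^ 2 * 1369 * L ^ 2 ≤ (L ^ 2) ^ 2 * L ^ 2 * L ^ 2 := by
      have := mul_le_mul hL4 hLsq (by norm_num) (by positivity)
      nlinarith [this, hL2pos]
    have h2 : (L / 2) ^ 8 / 40320 = (L ^ 2) ^ 2 * L ^ 2 * L ^ 2 / 10321920 := by ring
    rw [h2] at hE8
    nlinarith [h1, hE8]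
  have hEbig2 : (4600000 : ℝ) ≤ E := by
    have h1 : Real.exp 18 ≤ E := Real.exp_le_exp.mpr (by linarith)
    exact numeral_le_exp_18.trans h1
  -- s = ⌊√N⌋, X = s / c
  set s := Nat.sqrt N with hsdef
  set X := s / c with hXdef
  have hs2 : (s : ℝ) ^ 2 ≤ N := by exact_mod_cast Nat.sqrt_le' N
  have hs2' : (N : ℝ) < ((s : ℝ) + 1) ^ 2 := by exact_mod_cast Nat.lt_succ_sqrt' N
  have hsE : (s : ℝ) ≤ E := by
    have : (s : ℝ) ^ 2 ≤ E ^ 2 := by rw [hE2]; exact hs2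
    exact (pow_le_pow_iff_left₀ (Nat.cast_nonneg s) hE0.le two_ne_zero).mp this
  have hEs : E < (s : ℝ) + 1 := by
    have : E ^ 2 < ((s : ℝ) + 1) ^ 2 := by rw [hE2]; exact hs2'
    exact (pow_lt_pow_iff_left₀ hE0.le (by positivity) two_ne_zero).mp this
  have hXc : X * c ≤ s := Nat.div_mul_le_self s c
  have hXc' : s + 1 ≤ X * c + c := Nat.lt_div_mul_add hcpos
  have hXcR : (X : ℝ) * c ≤ s := by exact_mod_cast hXc
  have hXcR' : (s : ℝ) + 1 ≤ (X : ℝ) * c + c := by exact_mod_cast hXc'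
  have hX0R : (0 : ℝ) ≤ X := Nat.cast_nonneg X
  have hXR : (X : ℝ) ^ 2 * (c : ℝ) ^ 2 ≤ (N : ℝ) := by
    have : ((X : ℝ) * c) ^ 2 ≤ (s : ℝ) ^ 2 := pow_le_pow_left₀ (by positivity) hXcR 2
    nlinarith [hs2, this]
  have hXlo : E / c - 1 < (X : ℝ) := by
    have h1 : E < (X : ℝ) * c + c := by linarith [hEs, hXcR']
    rw [sub_lt_iff_lt_add, div_lt_iff₀ hc0]; linarith
  have hXhi : (X : ℝ) ≤ E / c := by
    rw [le_div_iff₀ hc0]; linarith [hsE, hXcR]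
  have hEc : (262145 : ℝ) ≤ E / c := by
    rw [le_div_iff₀ hc0]; nlinarith [hEbig2, hcR32]
  have hX0 : (0 : ℝ) < X := by linarith
  have hX4194304 : 4194304 ≤ X := by
    have h54 : ((4503599627370496 : ℕ) : ℝ) ≤ (N : ℝ) := by
      have := numeral_le_exp_37.trans ((Real.exp_le_exp.mpr hΛ).trans hN)
      push_cast; linarith
    have h54' : 4503599627370496 ≤ N := by exact_mod_cast h54
    have hs27 : 67108864 ≤ s := by
      rw [hsdef, Nat.le_sqrt]
      calc 67108864 * 67108864 = 4503599627370496 := by norm_num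
        _ ≤ N := h54'
    rw [hXdef]
    exact (Nat.le_div_iff_mul_le hcpos).mpr (by
      calc 4194304 * c ≤ 4194304 * 16 := Nat.mul_le_mul_left _ hc16
        _ ≤ s := by omega)
  -- log X ≥ l₁ := L/2 − lc
  set l₁ := L / 2 - lc with hl₁def
  have hexp : Real.exp l₁ ≤ (X : ℝ) := by
    rw [hl₁def, Real.exp_sub]
    have hlc0 : (0 : ℝ) < (c : ℝ) * 1.00012 := by positivity
    have h1 : E / Real.exp lc ≤ E / ((c : ℝ) * 1.00012) :=
      div_le_div_of_nonneg_left hE0.le hlc0 hlc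
    have h2 : E / ((c : ℝ) * 1.00012) ≤ E / c - 1 := by
      rw [show E / ((c : ℝ) * 1.00012) = E / c / 1.00012 by rw [div_div],
        div_le_iff₀ (by norm_num : (0 : ℝ) < 1.00012)]
      linarith [hEc]
    linarith [hXlo]
  have hl : l₁ ≤ Real.log X := by
    rw [Real.le_log_iff_exp_le hX0]; exact hexp
  have hl₁ : (17.2 : ℝ) ≤ l₁ := by rw [hl₁def]; linarith
  -- Q ≥ TlowK4(log X) ≥ TlowK4(l₁) ≥ 88
  set Q := GoldbachSieveEight.Qsum ∅ X with hQdef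
  have hQ : TlowK4 (Real.log X) ≤ Q := Qsum_ge_kappa4 hX4194304
  have hQT : TlowK4 l₁ ≤ Q := le_trans (TlowK4_mono (by linarith) hl) hQ
  have hT₁ : (88 : ℝ) ≤ TlowK4 l₁ := TlowK4_ge88' hl₁
  have hQpos : 0 < Q := by linarith
  have hF0 : 0 ≤ F := le_trans zero_le_one hF1
  have hC1 : C ≤ ((X : ℝ) ^ 2 + N - 1) * F / Q + B := by
    have : C * Q ≤ (((X : ℝ) ^ 2 + N - 1) * F / Q + B) * Q := by
      rw [add_mul, div_mul_cancel₀ _ hQpos.ne']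
      exact hBD
    exact le_of_mul_le_mul_right this hQpos
  have hc2pos : (0 : ℝ) < (c : ℝ) ^ 2 := by positivity
  set K : ℝ := ((c : ℝ) ^ 2 + 1) / (c : ℝ) ^ 2 with hKdef
  have hK0 : 0 < K := by positivity
  have hC2 : ((X : ℝ) ^ 2 + N - 1) * F / Q ≤ K * (N : ℝ) * F / TlowK4 l₁ := by
    have hnum0 : 0 ≤ K * (N : ℝ) * F := by positivity
    have hXN : (X : ℝ) ^ 2 ≤ (N : ℝ) / (c : ℝ) ^ 2 := by rw [le_div_iff₀ hc2pos]; exact hXR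
    have hKN : (X : ℝ) ^ 2 + N - 1 ≤ K * N := by
      have : K * N = N / (c : ℝ) ^ 2 + N := by rw [hKdef]; field_simp; ring
      rw [this]; linarith
    have hnum : ((X : ℝ) ^ 2 + N - 1) * F ≤ K * (N : ℝ) * F := mul_le_mul_of_nonneg_right hKN hF0
    calc ((X : ℝ) ^ 2 + N - 1) * F / Q ≤ K * (N : ℝ) * F / Q := div_le_div_of_nonneg_right hnum hQpos.le
      _ ≤ K * (N : ℝ) * F / TlowK4 l₁ :=
          div_le_div_of_nonneg_left hnum0 (by linarith) hQT
  -- main term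
  have hmain : K * (N : ℝ) * F / TlowK4 l₁ ≤ (A - 0.02) * F * (N : ℝ) / L ^ 2 := by
    have hkey : ((c : ℝ) ^ 2 + 1) * L ^ 2 ≤ (c : ℝ) ^ 2 * (A - 0.02) * TlowK4 l₁ := hA L hL
    have hkey' : K * L ^ 2 ≤ (A - 0.02) * TlowK4 l₁ := by
      rw [hKdef, div_mul_eq_mul_div, div_le_iff₀ hc2pos]
      linarith [hkey]
    rw [div_le_div_iff₀ (by linarith) hL2pos]
    have hNF : 0 ≤ (N : ℝ) * F := by positivity
    have h := mul_le_mul_of_nonneg_left hkey' hNF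
    calc K * (N : ℝ) * F * L ^ 2 = (N : ℝ) * F * (K * L ^ 2) := by ring
      _ ≤ (N : ℝ) * F * ((A - 0.02) * TlowK4 l₁) := h
      _ = (A - 0.02) * F * (N : ℝ) * TlowK4 l₁ := by ring
  -- boundary term
  have htail : B ≤ 0.02 * F * (N : ℝ) / L ^ 2 := by
    have h2 : (E / 4 + 1) * L ^ 2 ≤ 0.01 * (N : ℝ) := by
      rw [← hE2]; exact tail_numeric37 hL40 hEL
    have h3 : 0.02 * (N : ℝ) ≤ 0.02 * F * (N : ℝ) :=
      calc 0.02 * (N : ℝ) ≤ F * (0.02 * (N : ℝ)) := le_mul_of_one_le_left (by positivity) hF1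
        _ = 0.02 * F * (N : ℝ) := by ring
    rw [le_div_iff₀ hL2pos]
    have h1 : B * L ^ 2 ≤ 2 * ((E / 4 + 1) * L ^ 2) := by
      have hEc4 : E / c ≤ E / 4 := div_le_div_of_nonneg_left hE0.le (by norm_num) hcR4
      have : B ≤ 2 * (E / 4 + 1) := by linarith only [hB, hXhi, hEc4]
      nlinarith only [this, hL2pos]
    linarith only [h1, h2, h3]
  calc C ≤ ((X : ℝ) ^ 2 + N - 1) * F / Q + B := hC1
    _ ≤ K * (N : ℝ) * F / TlowK4 l₁ + B := by linarith only [hC2]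
    _ ≤ (A - 0.02) * F * (N : ℝ) / L ^ 2 + 0.02 * F * (N : ℝ) / L ^ 2 := add_le_add hmain htail
    _ = A * F * (N : ℝ) / L ^ 2 := by ring

/-- **Explicit PRIME-PAIR sieve bound with length `⌊√N⌋/c`, from `e^37`**: under the numerics of
`explicit_of_largeSieve_kappa4_c37`, `#{p ≤ N : p + h prime} ≤ A·f(h)·N/log²N` for even `h ≠ 0`, `N ≥ e^Λ`.
[cite: BatemanDiamond2004, Thm 13.8 (explicit form proved here)] -/
theorem pairCount_le_of_numeric4_c37 {c : ℕ} {lc Λ A : ℝ} (hc4 : 4 ≤ c) (hc16 : c ≤ 16)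
    (hlc : (c : ℝ) * 1.00012 ≤ Real.exp lc) (hΛ : 37 ≤ Λ) (hΛc : 34.4 + 2 * lc ≤ Λ)
    (hA : ∀ L : ℝ, Λ ≤ L → ((c : ℝ) ^ 2 + 1) * L ^ 2
        ≤ (c : ℝ) ^ 2 * (A - 0.02) * TlowK4 (L / 2 - lc))
    {N h : ℕ} (hN : Real.exp Λ ≤ (N : ℝ)) (hh : h ≠ 0) (heven : Even h) :
    ((((Nat.primesLE N).filter fun p => (p + h).Prime).card : ℕ) : ℝ)
      ≤ A * oddSingularFactor h * (N : ℝ) / Real.log (N : ℝ) ^ 2 := by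
  have h40 : Real.exp 37 ≤ (N : ℝ) := (Real.exp_le_exp.mpr hΛ).trans hN
  have h20 : (2 : ℝ) ^ 20 ≤ (N : ℝ) := le_trans (by norm_num) (numeral_le_exp_37.trans h40)
  have hX1 : 1 ≤ Nat.sqrt N / c := by
    have h20' : 2 ^ 20 ≤ N := by exact_mod_cast h20
    have hs : 1024 ≤ Nat.sqrt N := by
      rw [Nat.le_sqrt]
      calc 1024 * 1024 = 2 ^ 20 := by norm_num
        _ ≤ N := h20'
    exact (Nat.le_div_iff_mul_le (by omega)).mpr (by omega)
  have hBD := GoldbachSieveEight.card_primePairs_mul_Qsum_le 1 h N (Nat.sqrt N / c) le_rfl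
    (Nat.one_le_iff_ne_zero.mpr hh) (by simpa using heven) hX1
  have hprod : (∏ p ∈ ((1 * h).primeFactors.filter (2 < ·)), (((p : ℝ) - 1) / ((p : ℝ) - 2)))
      = oddSingularFactor h := by rw [one_mul]; rfl
  rw [hprod] at hBD
  have hmain := explicit_of_largeSieve_kappa4_c37 hc4 hc16 hlc hΛ hΛc hA hN
    (one_le_oddSingularFactor' _) (by linarith) hBD
  have hcount : ((range (N + 1)).filter (fun p => p.Prime ∧ (1 * p + h).Prime)).card
      = ((Nat.primesLE N).filter fun p => (p + h).Prime).card := by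
    congr 1
    ext p
    simp only [mem_filter, mem_range, Nat.mem_primesLE, one_mul, Nat.lt_succ_iff]
    tauto
  rw [hcount] at hmain
  exact hmain

/-- `c = 4` numerics at `Λ = 37.29` on `TlowK4`: `17L² ≤ 16·13.03·TlowK4(L/2 − 1.3865)` for `L ≥ 37.29`. [folklore] -/
private theorem cells4_numeric4_3729 {L : ℝ} (hL : 37.29 ≤ L) :
    (((4 : ℕ) : ℝ) ^ 2 + 1) * L ^ 2 ≤ ((4 : ℕ) : ℝ) ^ 2 * (13.05 - 0.02) * TlowK4 (L / 2 - 1.3865) := by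
  unfold TlowK4
  push_cast
  nlinarith [hL, mul_self_nonneg (L - 37.29)]

/-- **PAIR SIEVE `13.05` above `e^{37.29}`** (`c = 4`, the 68 cells with the harmonic constant; ROUND-42/43: `13.01` from `e^38`).
[cite: BatemanDiamond2004, Thm 13.8, §13.4–13.5 pp. 325–328 (explicit form proved here)] -/
theorem pairCount_le_1305 {N h : ℕ} (hN : Real.exp 37.29 ≤ (N : ℝ)) (hh : h ≠ 0) (heven : Even h) :
    ((((Nat.primesLE N).filter fun p => (p + h).Prime).card : ℕ) : ℝ)
      ≤ 13.05 * oddSingularFactor h * (N : ℝ) / Real.log (N : ℝ) ^ 2 :=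
  pairCount_le_of_numeric4_c37 (c := 4) (lc := 1.3865) (by norm_num) (by norm_num)
    (by have := exp_13865_ge; push_cast; linarith) (by norm_num) (by norm_num)
    (fun _ hL => cells4_numeric4_3729 hL) hN hh heven

/-- `c = 16` numerics at `Λ = 297` on `TlowK4`: `257L² ≤ 256·11.33·TlowK4(L/2 − 2.7728)` for `L ≥ 297`. [folklore] -/
private theorem cells16_numeric4_297 {L : ℝ} (hL : 297 ≤ L) :
    (((16 : ℕ) : ℝ) ^ 2 + 1) * L ^ 2 ≤ ((16 : ℕ) : ℝ) ^ 2 * (11.35 - 0.02) * TlowK4 (L / 2 - 2.7728) := by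
  unfold TlowK4
  push_cast
  nlinarith [hL, mul_self_nonneg (L - 297)]

/-- **GOLDBACH SIEVE `11.35` above `e^297`** (`c = 16`, 68 cells, harmonic constant):
`r(N) ≤ 11.35·f(N)·N/log²N` for even `N ≥ e^297`. [cite: BatemanDiamond2004, §13.4 (13.13)–(13.14)] -/
theorem goldbachCount_le_1135 {N : ℕ} (hN : Real.exp 297 ≤ (N : ℝ)) (heven : Even N) :
    (SingularSeries.goldbachCount N : ℝ) ≤ 11.35 * oddSingularFactor N * (N : ℝ) / Real.log (N : ℝ) ^ 2 :=
  goldbachCount_le_of_numeric4_c (c := 16) (lc := 2.7728) (by norm_num) (by norm_num)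
    (by have := exp_27728_ge; push_cast; linarith) (by norm_num) (by norm_num)
    (fun _ hL => cells16_numeric4_297 hL) hN heven

/-! ### §28.2  The unconditional five-regime glue from `L₁ ≥ 37.29` with `h ≥ 19` (ROUND-44: round43 §E with PER-REGIME count
constants from the `m = 68` scheme (`ChebyshevCostaPereira68.lean`): `0.98133` (one/three shifts), `0.982815` (four), `0.984437` (seven/twelve);
thresholds `37.29/47.4/109/190`, pair constants `13.05/13.05/11.84/11.52`, weights `78.3/182.7/664.7/2233`) -/

set_option maxHeartbeats 16000000 in
/-- **UNCONDITIONAL GLUE FOR ALL `y ≥ 1`, FIVE REGIMES, `h ≥ 19`, `L₁ ≥ 37.29`** (ROUND-44 «CP-m»): one shift below `e^{L₁}`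
(`L₁ ≤ 1.96266h` with `π(n) ≥ 0.98133 n/log n` above `227·30000³` (`ChebyshevCostaPereira68.lean` shot 3); `π(n) ≥ 0.9636 n/log n` on `[227, 227·30000³)`
where `log n ≤ 36.4 ≤ 1.9272·19` (`ChebyshevCostaPereira.lean`); `(n+2)/20 ≤ π(n)` on `[122, 227)`, `π ≥ 3` below), THREE shifts `{3,5,7}` on
`(e^{L₁}, e^{Lt}]` (`three_shift_count`, the `e^{37.29}` pair sieve `pairCount_le_1305`, weight `6·13.05 = 78.3`, counts
`0.98133·(2y−q)/L`), FOUR shifts on `(e^{Lt}, e^{L₂}]`, `Lt ≥ 47.4` (counts `0.982815`, weight `14·13.05 = 182.7`), SEVEN shifts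
on `(e^{L₂}, e^{L₃}]` (`pairCount_le_1184` from `e^109`, weight `249232/375 ≤ 664.7`, counts `0.984437`), TWELVE shifts on
`(e^{L₃}, e^{Λ₀})` (`pairCount_le_1152` from `e^190`, weight `93923136/42075 ≤ 2233`, counts `0.984437`), the count above
`e^{Λ₀}`: `L² + h ≤ h·(5.88798L − 78.3)` on `[L₁, Lt]`, `L² + h ≤ h·(7.86252L − 182.7)` on `[Lt, L₂]`,
`L² + h ≤ h·(13.782118L − 664.7)` on `[L₂, L₃]`, `L² + h ≤ h·(23.626488L − 2233)` on `[L₃, Λ₀]`. [cite: Nathanson1996, Theorem 7.8 (five-regime explicit form for the halved Goldbach set, `m = 68` count constants per regime; proved here)] -/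
theorem half_count_ge_allN_cp37 {L₁ Lt L₂ L₃ Λ₀ : ℝ} {h : ℕ} (h20 : 19 ≤ h) (h38 : 37.29 ≤ L₁) (hL₁h : L₁ ≤ 1.96266 * h)
    (hLt : 47.4 ≤ Lt) (hL₂ : 109 ≤ L₂) (hL₃ : 190 ≤ L₃) (hΛ4 : Λ₀ ≤ 10000)
    (hquad3 : ∀ L : ℝ, L₁ ≤ L → L ≤ Lt → L ^ 2 + h ≤ h * (5.88798 * L - 78.3))
    (hquad : ∀ L : ℝ, Lt ≤ L → L ≤ L₂ → L ^ 2 + h ≤ h * (7.86252 * L - 182.7))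
    (hquad7 : ∀ L : ℝ, L₂ ≤ L → L ≤ L₃ → L ^ 2 + h ≤ h * (13.782118 * L - 664.7))
    (hquad12 : ∀ L : ℝ, L₃ ≤ L → L ≤ Λ₀ → L ^ 2 + h ≤ h * (23.626488 * L - 2233))
    (hlarge : ∀ x : ℕ, Real.exp Λ₀ ≤ (x : ℝ) →
      (x : ℝ) / (2 * h) ≤ #{N ∈ Ioc 0 x | Even N ∧ ∃ p q : ℕ, p.Prime ∧ q.Prime ∧ p + q = N})
    {y : ℕ} (hy : 1 ≤ y) :
    (y : ℝ) / h ≤ #{b ∈ Ioc 0 y | b ∈ (({0, 1} : Set ℕ) ∪ {m | ∃ p q : ℕ, p.Prime ∧ q.Prime ∧ p + q = 2 * m})} := by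
  set B : Set ℕ := ({0, 1} : Set ℕ) ∪ {m | ∃ p q : ℕ, p.Prime ∧ q.Prime ∧ p + q = 2 * m} with hB
  have hhr : (19 : ℝ) ≤ h := by exact_mod_cast h20
  have hh0 : (0 : ℝ) < h := by linarith
  have hL₁pos : (0 : ℝ) < L₁ := by linarith
  by_cases hbig : Real.exp Λ₀ ≤ ((2 * y : ℕ) : ℝ)
  · have h1 := hlarge (2 * y) hbig
    have h2 := even_goldbach_card_le_half y
    have e : ((2 * y : ℕ) : ℝ) / (2 * h) = (y : ℝ) / h := by
      push_cast
      field_simp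
    rw [e] at h1
    exact h1.trans (by exact_mod_cast h2)
  rw [not_le] at hbig
  by_cases hsmall : y ≤ h
  · have h1 : 1 ≤ #{b ∈ Ioc 0 y | b ∈ B} :=
      card_pos.mpr ⟨1, by
        rw [mem_filter, mem_Ioc]
        exact ⟨⟨by omega, hy⟩, Or.inl (by simp)⟩⟩
    have h1' : (1 : ℝ) ≤ #{b ∈ Ioc 0 y | b ∈ B} := by exact_mod_cast h1
    have h2 : (y : ℝ) / h ≤ 1 := by
      rw [div_le_one hh0]
      exact_mod_cast hsmall
    linarith
  rw [not_le] at hsmall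
  have hy29 : 20 ≤ y := by omega
  have hnr : ((2 * y - 3 : ℕ) : ℝ) = 2 * (y : ℝ) - 3 := cast_two_mul_sub_three (by omega)
  have hy29r : (20 : ℝ) ≤ y := by exact_mod_cast hy29
  have hy0 : (0 : ℝ) < y := by linarith
  have hn55 : 37 ≤ 2 * y - 3 := by omega
  have hn0 : (0 : ℝ) < ((2 * y - 3 : ℕ) : ℝ) := by rw [hnr]; linarith
  have hn1 : (1 : ℝ) < ((2 * y - 3 : ℕ) : ℝ) := by rw [hnr]; linarith
  have hlogpos : 0 < Real.log ((2 * y - 3 : ℕ) : ℝ) := Real.log_pos hn1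
  by_cases hmid : Real.log ((2 * y - 3 : ℕ) : ℝ) ≤ L₁
  · -- ONE SHIFT below `e^{L₁}` (§15)
    have hemb := primeCounting_shift_le_half_count (y := y) (by omega)
    have hembr : (Nat.primeCounting (2 * y - 3) : ℝ) + 1 ≤ #{b ∈ Ioc 0 y | b ∈ B} := by exact_mod_cast hemb
    refine le_trans ?_ hembr
    by_cases hX3 : 6129000000000000 ≤ 2 * y - 3
    · -- `2y − 3 ≥ 227·30000³`: the `m = 68` constant `0.98133` (`ChebyshevCostaPereira68.lean`, shot 3), `L₁ ≤ 1.96266 h`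
      have hπ : 0.98133 * ((2 * y - 3 : ℕ) : ℝ) / Real.log ((2 * y - 3 : ℕ) : ℝ)
          ≤ (Nat.primeCounting (2 * y - 3) : ℝ) := Literature.NumberTheory.LFunctions.CostaPereira68.primeCounting_ge_3 hX3
      have h2 : 0.98133 * ((2 * y - 3 : ℕ) : ℝ) / L₁
          ≤ 0.98133 * ((2 * y - 3 : ℕ) : ℝ) / Real.log ((2 * y - 3 : ℕ) : ℝ) :=
        div_le_div_of_nonneg_left (by positivity) hlogpos hmid
      have h3 : (y : ℝ) / h ≤ 1.96266 * y / L₁ := by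
        rw [div_le_div_iff₀ hh0 hL₁pos]
        nlinarith [mul_le_mul_of_nonneg_left hL₁h hy0.le]
      have h4 : 1.96266 * (y : ℝ) / L₁ ≤ 0.98133 * ((2 * y - 3 : ℕ) : ℝ) / L₁ + 1 := by
        rw [hnr]
        have e : 0.98133 * (2 * (y : ℝ) - 3) / L₁ = 1.96266 * y / L₁ - 2.94399 / L₁ := by
          field_simp
          ring
        rw [e]
        have : 2.94399 / L₁ ≤ 1 := by
          rw [div_le_one hL₁pos]
          linarith
        linarith
      linarith [h2, h3, h4, hπ]
    rw [not_le] at hX3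
    by_cases h6 : 227 ≤ 2 * y - 3
    · -- `227 ≤ 2y − 3 < 227·30000³`: `log(2y − 3) ≤ 36.4 ≤ 1.9272·19`, Costa Pereira's `0.9636` (`ChebyshevCostaPereira.lean`)
      have hlog36 : Real.log ((2 * y - 3 : ℕ) : ℝ) ≤ 36.4 := by
        have h1 : ((2 * y - 3 : ℕ) : ℝ) ≤ Real.exp 36.4 := by
          have : ((2 * y - 3 : ℕ) : ℝ) ≤ (6129000000000000 : ℝ) := by exact_mod_cast hX3.le
          exact this.trans X3_le_exp_364
        have := Real.log_le_log hn0 h1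
        rwa [Real.log_exp] at this
      have hπ : 0.9636 * ((2 * y - 3 : ℕ) : ℝ) / Real.log ((2 * y - 3 : ℕ) : ℝ)
          ≤ (Nat.primeCounting (2 * y - 3) : ℝ) := Literature.NumberTheory.LFunctions.CostaPereira.primeCounting_ge h6
      have h2 : 0.9636 * ((2 * y - 3 : ℕ) : ℝ) / 36.4
          ≤ 0.9636 * ((2 * y - 3 : ℕ) : ℝ) / Real.log ((2 * y - 3 : ℕ) : ℝ) :=
        div_le_div_of_nonneg_left (by positivity) hlogpos hlog36
      have h3 : (y : ℝ) / h ≤ 1.9272 * y / 36.4 := by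
        rw [div_le_div_iff₀ hh0 (by norm_num)]
        nlinarith [mul_le_mul_of_nonneg_left hhr hy0.le]
      have h4 : 1.9272 * (y : ℝ) / 36.4 ≤ 0.9636 * ((2 * y - 3 : ℕ) : ℝ) / 36.4 + 1 := by
        rw [hnr]
        have e : 0.9636 * (2 * (y : ℝ) - 3) / 36.4 = 1.9272 * y / 36.4 - 2.8908 / 36.4 := by
          ring
        rw [e]
        have : (2.8908 : ℝ) / 36.4 ≤ 1 := by norm_num
        linarith
      linarith [h2, h3, h4, hπ]
    · rw [not_le] at h6
      -- `2y − 3 < 227`: Chebyshev pointwise `(n + 2)/20 ≤ π(n)` for `n ≥ 122` (§7.3), `π(n) ≥ π(5) = 3` below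
      by_cases h88 : 122 ≤ 2 * y - 3
      · have hlog14 : Real.log ((2 * y - 3 : ℕ) : ℝ) ≤ 14 := log_le_14_of_lt (by omega) (by omega)
        have hπ := primeCounting_ge_div20 h88 hlog14
        rw [hnr] at hπ
        have h6' : (y : ℝ) / h ≤ (y : ℝ) / 19 := div_le_div_of_nonneg_left hy0.le (by norm_num) hhr
        have h7 : (y : ℝ) / 19 ≤ (2 * (y : ℝ) - 3 + 2) / 20 + 1 := by
          rw [div_le_iff₀ (by norm_num : (0 : ℝ) < 19)]
          linarith
        linarith [hπ, h6', h7]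
      · rw [not_le] at h88
        have hπ5 : Nat.primeCounting 5 = 3 := by decide
        have hmono := Nat.monotone_primeCounting (show 5 ≤ 2 * y - 3 by omega)
        rw [hπ5] at hmono
        have hπ3 : (3 : ℝ) ≤ (Nat.primeCounting (2 * y - 3) : ℝ) := by exact_mod_cast hmono
        have hy62 : (y : ℝ) ≤ 62 := by exact_mod_cast (show y ≤ 62 by omega)
        have h7 : (y : ℝ) / h ≤ 4 := by
          rw [div_le_iff₀ hh0]
          linarith
        linarith
  · -- SHIFTS on `(e^{L₁}, e^{Λ₀})`: three / four / seven / twelve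
    rw [not_le] at hmid
    have h59 : (6130000000000000 : ℝ) < ((2 * y - 3 : ℕ) : ℝ) := by
      have h1 : Real.exp L₁ < ((2 * y - 3 : ℕ) : ℝ) := by
        by_contra hc
        rw [not_lt] at hc
        have := Real.log_le_log hn0 hc
        rw [Real.log_exp] at this
        linarith
      exact lt_of_le_of_lt (numeral_le_exp_37.trans (Real.exp_le_exp.mpr (by linarith))) h1
    have h59n : 6130000000000000 < 2 * y - 3 := by exact_mod_cast h59
    have hy58 : (3065000000000000 : ℝ) ≤ (y : ℝ) := by
      have : 3065000000000000 ≤ y := by omega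
      exact_mod_cast this
    have h2y0 : (0 : ℝ) < ((2 * y : ℕ) : ℝ) := by push_cast; linarith
    set L := Real.log ((2 * y : ℕ) : ℝ) with hLdef
    have hLΛ : L < Λ₀ := by
      have := Real.log_lt_log h2y0 hbig
      rwa [Real.log_exp] at this
    have hL₁L : L₁ ≤ L := by
      have h2y : ((2 * y - 3 : ℕ) : ℝ) ≤ ((2 * y : ℕ) : ℝ) := by rw [hnr]; push_cast; linarith
      exact (hmid.trans_le (Real.log_le_log hn0 h2y)).le
    have hL40 : (37.29 : ℝ) ≤ L := h38.trans hL₁L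
    have hLpos : (0 : ℝ) < L := by linarith
    have hL4 : L ≤ 10000 := by linarith
    have he40 : Real.exp 37.29 ≤ ((2 * y : ℕ) : ℝ) := by
      have : Real.exp 37.29 ≤ Real.exp L := Real.exp_le_exp.mpr hL40
      rwa [hLdef, Real.exp_log h2y0] at this
    -- the prime counts above `227·30000³`: the `m = 68` constant `0.98133` (`ChebyshevCostaPereira68.lean`, shot 3)
    have hπA : ∀ q : ℕ, q ≤ 41 → 0.98133 * (2 * (y : ℝ) - q) / L ≤ (Nat.primeCounting (2 * y - q) : ℝ) := by
      intro q hq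
      have hqr : (q : ℝ) ≤ 41 := by exact_mod_cast hq
      have hnq : ((2 * y - q : ℕ) : ℝ) = 2 * (y : ℝ) - q := cast_two_mul_sub (by omega)
      have h6 : 6129000000000000 ≤ 2 * y - q := by omega
      have hnq0 : (0 : ℝ) < ((2 * y - q : ℕ) : ℝ) := by rw [hnq]; linarith
      have hnq1 : (1 : ℝ) < ((2 * y - q : ℕ) : ℝ) := by rw [hnq]; linarith
      have h1 : 0.98133 * ((2 * y - q : ℕ) : ℝ) / Real.log ((2 * y - q : ℕ) : ℝ)
          ≤ (Nat.primeCounting (2 * y - q) : ℝ) := Literature.NumberTheory.LFunctions.CostaPereira68.primeCounting_ge_3 h6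
      have hlogq0 : 0 < Real.log ((2 * y - q : ℕ) : ℝ) := Real.log_pos hnq1
      have hlogq : Real.log ((2 * y - q : ℕ) : ℝ) ≤ L := by
        have h2y : ((2 * y - q : ℕ) : ℝ) ≤ ((2 * y : ℕ) : ℝ) := by
          rw [hnq]; push_cast; linarith [Nat.cast_nonneg (α := ℝ) q]
        exact Real.log_le_log hnq0 h2y
      have h2 : 0.98133 * (2 * (y : ℝ) - q) / L
          ≤ 0.98133 * ((2 * y - q : ℕ) : ℝ) / Real.log ((2 * y - q : ℕ) : ℝ) := by
        rw [← hnq]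
        exact div_le_div_of_nonneg_left (by positivity) hlogq0 hlogq
      linarith
    -- the pair counts (the 68-cell pair sieve with the harmonic constant above `e^37.29`, ROUND-44)
    have hP : ∀ d : ℕ, d ≠ 0 → Even d →
        (#((Nat.primesLE (2 * y)).filter (fun p => (p + d).Prime)) : ℝ)
          ≤ 13.05 * oddSingularFactor d * ((2 * y : ℕ) : ℝ) / L ^ 2 := by
      intro d hd hde
      exact pairCount_le_1305 (N := 2 * y) (h := d) he40 hd hde
    rcases le_or_gt L Lt with hmidt | hmidt
    · -- THREE SHIFTS `{3, 5, 7}` on `(e^{L₁}, e^{Lt}]`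
      have hq := hquad3 L hL₁L hmidt
      have hP2 := hP 2 (by norm_num) (by norm_num)
      have hP4 := hP 4 (by norm_num) (by norm_num)
      rw [oddSingularFactor_two'] at hP2
      rw [oddSingularFactor_four] at hP4
      have hcomb := three_shift_count (y := y) (by omega)
      have hcombr : (Nat.primeCounting (2 * y - 3) : ℝ) + Nat.primeCounting (2 * y - 5)
          + Nat.primeCounting (2 * y - 7)
          ≤ (#{b ∈ Ioc 0 y | b ∈ B} : ℝ) + 2
            + (2 * #((Nat.primesLE (2 * y)).filter (fun p => (p + 2).Prime))
              + #((Nat.primesLE (2 * y)).filter (fun p => (p + 4).Prime))) := by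
        exact_mod_cast hcomb
      have hπ3 := hπA 3 (by norm_num)
      have hπ5 := hπA 5 (by norm_num)
      have hπ7 := hπA 7 (by norm_num)
      push_cast at hπ3 hπ5 hπ7
      have h2yr : ((2 * y : ℕ) : ℝ) = 2 * (y : ℝ) := by push_cast; ring
      rw [h2yr] at hP2 hP4
      set G : ℝ := (#{b ∈ Ioc 0 y | b ∈ B} : ℝ) with hG
      set Y : ℝ := (y : ℝ) with hY
      -- `G ≥ (5.88798 Y − 14.71995)/L − 2 − 78.3 Y/L²`
      have hG1 : (5.88798 * Y - 14.71995) / L - 2 - 78.3 * Y / L ^ 2 ≤ G := by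
        have e1 : (5.88798 * Y - 14.71995) / L = 0.98133 * (2 * Y - 3) / L + 0.98133 * (2 * Y - 5) / L
            + 0.98133 * (2 * Y - 7) / L := by
          field_simp
          ring
        have e2 : 78.3 * Y / L ^ 2 = 2 * (13.05 * 1 * (2 * Y) / L ^ 2) + 13.05 * 1 * (2 * Y) / L ^ 2 := by
          field_simp
          ring
        rw [e1, e2]
        linarith [hcombr, hπ3, hπ5, hπ7, hP2, hP4]
      have hL2 : (0 : ℝ) < L ^ 2 := by positivity
      have hkey : Y * L ^ 2 ≤ (h : ℝ) * G * L ^ 2 := by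
        have e3 : ((5.88798 * Y - 14.71995) / L - 2 - 78.3 * Y / L ^ 2) * L ^ 2
            = 5.88798 * Y * L - 14.71995 * L - 2 * L ^ 2 - 78.3 * Y := by
          field_simp
        have h1 : (5.88798 * Y * L - 14.71995 * L - 2 * L ^ 2 - 78.3 * Y) * h ≤ G * L ^ 2 * h := by
          rw [← e3]
          exact mul_le_mul_of_nonneg_right (mul_le_mul_of_nonneg_right hG1 hL2.le) hh0.le
        have h2 : Y * (L ^ 2 + h) ≤ Y * (h * (5.88798 * L - 78.3)) :=
          mul_le_mul_of_nonneg_left hq (by linarith)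
        have h3 : 14.71995 * L + 2 * L ^ 2 ≤ Y := by
          nlinarith [mul_nonneg (sub_nonneg.2 hL4) hLpos.le]
        have h3' : (h : ℝ) * (14.71995 * L + 2 * L ^ 2) ≤ h * Y := mul_le_mul_of_nonneg_left h3 hh0.le
        nlinarith [h1, h2, h3']
      have hfin := le_of_mul_le_mul_right hkey hL2
      rw [div_le_iff₀ hh0, mul_comm]
      exact hfin
    · rcases le_or_gt L L₂ with hmid2 | hmid2
      · -- FOUR SHIFTS on `(e^{Lt}, e^{L₂}]`
        have hq := hquad L hmidt.le hmid2
        -- the prime counts above `227·30000^4`: the `m = 68` constant `0.982815` (`ChebyshevCostaPereira68.lean`, shot 4)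
        have heS : Real.exp 47 ≤ ((2 * y : ℕ) : ℝ) := by
          have : Real.exp 47 ≤ Real.exp L := Real.exp_le_exp.mpr (by linarith)
          rwa [hLdef, Real.exp_log h2y0] at this
        have hNS : 183880000000000000000 ≤ 2 * y := by
          have : ((183880000000000000000 : ℕ) : ℝ) ≤ ((2 * y : ℕ) : ℝ) := by
            have := numeral_le_exp_47.trans heS; push_cast at this ⊢; linarith
          exact_mod_cast this
        have hπB : ∀ q : ℕ, q ≤ 41 → 0.982815 * (2 * (y : ℝ) - q) / L ≤ (Nat.primeCounting (2 * y - q) : ℝ) := by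
          intro q hq
          have hqr : (q : ℝ) ≤ 41 := by exact_mod_cast hq
          have hnq : ((2 * y - q : ℕ) : ℝ) = 2 * (y : ℝ) - q := cast_two_mul_sub (by omega)
          have h6 : 183870000000000000000 ≤ 2 * y - q := by omega
          have hnq0 : (0 : ℝ) < ((2 * y - q : ℕ) : ℝ) := by rw [hnq]; linarith
          have hnq1 : (1 : ℝ) < ((2 * y - q : ℕ) : ℝ) := by rw [hnq]; linarith
          have h1 : 0.982815 * ((2 * y - q : ℕ) : ℝ) / Real.log ((2 * y - q : ℕ) : ℝ)
              ≤ (Nat.primeCounting (2 * y - q) : ℝ) := Literature.NumberTheory.LFunctions.CostaPereira68.primeCounting_ge_4 h6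
          have hlogq0 : 0 < Real.log ((2 * y - q : ℕ) : ℝ) := Real.log_pos hnq1
          have hlogq : Real.log ((2 * y - q : ℕ) : ℝ) ≤ L := by
            have h2y : ((2 * y - q : ℕ) : ℝ) ≤ ((2 * y : ℕ) : ℝ) := by
              rw [hnq]; push_cast; linarith [Nat.cast_nonneg (α := ℝ) q]
            exact Real.log_le_log hnq0 h2y
          have h2 : 0.982815 * (2 * (y : ℝ) - q) / L
              ≤ 0.982815 * ((2 * y - q : ℕ) : ℝ) / Real.log ((2 * y - q : ℕ) : ℝ) := by
            rw [← hnq]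
            exact div_le_div_of_nonneg_left (by positivity) hlogq0 hlogq
          linarith
        have hP2 := hP 2 (by norm_num) (by norm_num)
        have hP4 := hP 4 (by norm_num) (by norm_num)
        have hP6 := hP 6 (by norm_num) (by norm_num)
        have hP8 := hP 8 (by norm_num) (by norm_num)
        rw [oddSingularFactor_two'] at hP2
        rw [oddSingularFactor_four] at hP4
        rw [oddSingularFactor_six] at hP6
        rw [oddSingularFactor_eight] at hP8
        -- combinatorics
        have hcomb := four_shift_count (y := y) (by omega)
        have hcombr : (Nat.primeCounting (2 * y - 3) : ℝ) + Nat.primeCounting (2 * y - 5)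
            + Nat.primeCounting (2 * y - 7) + Nat.primeCounting (2 * y - 11)
            ≤ (#{b ∈ Ioc 0 y | b ∈ B} : ℝ) + 2
              + (2 * #((Nat.primesLE (2 * y)).filter (fun p => (p + 2).Prime))
                + 2 * #((Nat.primesLE (2 * y)).filter (fun p => (p + 4).Prime))
                + #((Nat.primesLE (2 * y)).filter (fun p => (p + 8).Prime))
                + #((Nat.primesLE (2 * y)).filter (fun p => (p + 6).Prime))) := by
          exact_mod_cast hcomb
        have hπ3 := hπB 3 (by norm_num)
        have hπ5 := hπB 5 (by norm_num)
        have hπ7 := hπB 7 (by norm_num)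
        have hπ11 := hπB 11 (by norm_num)
        push_cast at hπ3 hπ5 hπ7 hπ11
        have h2yr : ((2 * y : ℕ) : ℝ) = 2 * (y : ℝ) := by push_cast; ring
        rw [h2yr] at hP2 hP4 hP6 hP8
        set G : ℝ := (#{b ∈ Ioc 0 y | b ∈ B} : ℝ) with hG
        set Y : ℝ := (y : ℝ) with hY
        -- `G ≥ (7.86252 Y − 25.55319)/L − 2 − 182.7 Y/L²`
        have hG1 : (7.86252 * Y - 25.55319) / L - 2 - 182.7 * Y / L ^ 2 ≤ G := by
          have e1 : (7.86252 * Y - 25.55319) / L = 0.982815 * (2 * Y - 3) / L + 0.982815 * (2 * Y - 5) / L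
              + 0.982815 * (2 * Y - 7) / L + 0.982815 * (2 * Y - 11) / L := by
            field_simp
            ring
          have e2 : 182.7 * Y / L ^ 2 = 2 * (13.05 * 1 * (2 * Y) / L ^ 2) + 2 * (13.05 * 1 * (2 * Y) / L ^ 2)
              + 13.05 * 1 * (2 * Y) / L ^ 2 + 13.05 * 2 * (2 * Y) / L ^ 2 := by
            field_simp
            ring
          rw [e1, e2]
          linarith [hcombr, hπ3, hπ5, hπ7, hπ11, hP2, hP4, hP6, hP8]
        have hL2 : (0 : ℝ) < L ^ 2 := by positivity
        have hkey : Y * L ^ 2 ≤ (h : ℝ) * G * L ^ 2 := by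
          have e3 : ((7.86252 * Y - 25.55319) / L - 2 - 182.7 * Y / L ^ 2) * L ^ 2
              = 7.86252 * Y * L - 25.55319 * L - 2 * L ^ 2 - 182.7 * Y := by
            field_simp
          have h1 : (7.86252 * Y * L - 25.55319 * L - 2 * L ^ 2 - 182.7 * Y) * h ≤ G * L ^ 2 * h := by
            rw [← e3]
            exact mul_le_mul_of_nonneg_right (mul_le_mul_of_nonneg_right hG1 hL2.le) hh0.le
          have h2 : Y * (L ^ 2 + h) ≤ Y * (h * (7.86252 * L - 182.7)) :=
            mul_le_mul_of_nonneg_left hq (by linarith)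
          have h3 : 25.55319 * L + 2 * L ^ 2 ≤ Y := by
            nlinarith [mul_nonneg (sub_nonneg.2 hL4) hLpos.le]
          have h3' : (h : ℝ) * (25.55319 * L + 2 * L ^ 2) ≤ h * Y := mul_le_mul_of_nonneg_left h3 hh0.le
          nlinarith [h1, h2, h3']
        have hfin := le_of_mul_le_mul_right hkey hL2
        rw [div_le_iff₀ hh0, mul_comm]
        exact hfin
      · rcases le_or_gt L L₃ with hmid3 | hmid3
        · -- SEVEN SHIFTS on `(e^{L₂}, e^{L₃}]`
          have hq := hquad7 L hmid2.le hmid3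
          have he109 : Real.exp 109 ≤ ((2 * y : ℕ) : ℝ) := by
            have : Real.exp 109 ≤ Real.exp L := Real.exp_le_exp.mpr (hL₂.trans hmid2.le)
            rwa [hLdef, Real.exp_log h2y0] at this
          -- the prime counts above `227·30000^9`: the `m = 68` constant `0.984437` (`ChebyshevCostaPereira68.lean`, shot 9)
          have heS : Real.exp 109 ≤ ((2 * y : ℕ) : ℝ) := by
            have : Real.exp 109 ≤ Real.exp L := Real.exp_le_exp.mpr (by linarith)
            rwa [hLdef, Real.exp_log h2y0] at this
          have hNS : 100000000000000000000000000000000000000000000000 ≤ 2 * y := by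
            have : ((100000000000000000000000000000000000000000000000 : ℕ) : ℝ) ≤ ((2 * y : ℕ) : ℝ) := by
              have := ten_pow_47_le_exp_109.trans heS; push_cast at this ⊢; linarith
            exact_mod_cast this
          have hπC : ∀ q : ℕ, q ≤ 41 → 0.984437 * (2 * (y : ℝ) - q) / L ≤ (Nat.primeCounting (2 * y - q) : ℝ) := by
            intro q hq
            have hqr : (q : ℝ) ≤ 41 := by exact_mod_cast hq
            have hnq : ((2 * y - q : ℕ) : ℝ) = 2 * (y : ℝ) - q := cast_two_mul_sub (by omega)
            have h6 : 4468041000000000000000000000000000000000000 ≤ 2 * y - q := by omega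
            have hnq0 : (0 : ℝ) < ((2 * y - q : ℕ) : ℝ) := by rw [hnq]; linarith
            have hnq1 : (1 : ℝ) < ((2 * y - q : ℕ) : ℝ) := by rw [hnq]; linarith
            have h1 : 0.984437 * ((2 * y - q : ℕ) : ℝ) / Real.log ((2 * y - q : ℕ) : ℝ)
                ≤ (Nat.primeCounting (2 * y - q) : ℝ) := Literature.NumberTheory.LFunctions.CostaPereira68.primeCounting_ge_9 h6
            have hlogq0 : 0 < Real.log ((2 * y - q : ℕ) : ℝ) := Real.log_pos hnq1
            have hlogq : Real.log ((2 * y - q : ℕ) : ℝ) ≤ L := by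
              have h2y : ((2 * y - q : ℕ) : ℝ) ≤ ((2 * y : ℕ) : ℝ) := by
                rw [hnq]; push_cast; linarith [Nat.cast_nonneg (α := ℝ) q]
              exact Real.log_le_log hnq0 h2y
            have h2 : 0.984437 * (2 * (y : ℝ) - q) / L
                ≤ 0.984437 * ((2 * y - q : ℕ) : ℝ) / Real.log ((2 * y - q : ℕ) : ℝ) := by
              rw [← hnq]
              exact div_le_div_of_nonneg_left (by positivity) hlogq0 hlogq
            linarith
          have hP7 : ∀ d : ℕ, d ≠ 0 → Even d →
              (#((Nat.primesLE (2 * y)).filter (fun p => (p + d).Prime)) : ℝ)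
                ≤ 11.84 * oddSingularFactor d * ((2 * y : ℕ) : ℝ) / L ^ 2 := by
            intro d hd hde
            rw [hLdef]
            exact pairCount_le_1184 (N := 2 * y) (h := d) he109 hd hde
          have hP2 := hP7 2 (by norm_num) (by norm_num)
          have hP4 := hP7 4 (by norm_num) (by norm_num)
          have hP6 := hP7 6 (by norm_num) (by norm_num)
          have hP8 := hP7 8 (by norm_num) (by norm_num)
          have hP10 := hP7 10 (by norm_num) (by norm_num)
          have hP12 := hP7 12 (by norm_num) (by norm_num)
          have hP14 := hP7 14 (by norm_num) (by norm_num)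
          have hP16 := hP7 16 (by norm_num) (by norm_num)
          rw [oddSingularFactor_two'] at hP2
          rw [oddSingularFactor_four] at hP4
          rw [oddSingularFactor_six] at hP6
          rw [oddSingularFactor_eight] at hP8
          rw [oddSingularFactor_ten] at hP10
          rw [oddSingularFactor_twelve] at hP12
          rw [oddSingularFactor_fourteen] at hP14
          rw [oddSingularFactor_sixteen] at hP16
          have hcomb := seven_shift_count (y := y) (by omega)
          have hcombr : (Nat.primeCounting (2 * y - 3) : ℝ) + Nat.primeCounting (2 * y - 5)
              + Nat.primeCounting (2 * y - 7) + Nat.primeCounting (2 * y - 11) + Nat.primeCounting (2 * y - 13)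
              + Nat.primeCounting (2 * y - 17) + Nat.primeCounting (2 * y - 19)
              ≤ (#{b ∈ Ioc 0 y | b ∈ B} : ℝ) + 5
                + (4 * #((Nat.primesLE (2 * y)).filter (fun p => (p + 2).Prime))
                  + 3 * #((Nat.primesLE (2 * y)).filter (fun p => (p + 4).Prime))
                  + 4 * #((Nat.primesLE (2 * y)).filter (fun p => (p + 6).Prime))
                  + 3 * #((Nat.primesLE (2 * y)).filter (fun p => (p + 8).Prime))
                  + 2 * #((Nat.primesLE (2 * y)).filter (fun p => (p + 10).Prime))
                  + 2 * #((Nat.primesLE (2 * y)).filter (fun p => (p + 12).Prime))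
                  + 2 * #((Nat.primesLE (2 * y)).filter (fun p => (p + 14).Prime))
                  + #((Nat.primesLE (2 * y)).filter (fun p => (p + 16).Prime))) := by
            exact_mod_cast hcomb
          have hπ3 := hπC 3 (by norm_num)
          have hπ5 := hπC 5 (by norm_num)
          have hπ7 := hπC 7 (by norm_num)
          have hπ11 := hπC 11 (by norm_num)
          have hπ13 := hπC 13 (by norm_num)
          have hπ17 := hπC 17 (by norm_num)
          have hπ19 := hπC 19 (by norm_num)
          push_cast at hπ3 hπ5 hπ7 hπ11 hπ13 hπ17 hπ19
          have h2yr : ((2 * y : ℕ) : ℝ) = 2 * (y : ℝ) := by push_cast; ring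
          rw [h2yr] at hP2 hP4 hP6 hP8 hP10 hP12 hP14 hP16
          set G : ℝ := (#{b ∈ Ioc 0 y | b ∈ B} : ℝ) with hG
          set Y : ℝ := (y : ℝ) with hY
          have hY0 : 0 ≤ Y := le_trans (by norm_num) hy58
          have hL2 : (0 : ℝ) < L ^ 2 := by positivity
          have hG1 : (13.782118 * Y - 73.832775) / L - 5 - 664.7 * Y / L ^ 2 ≤ G := by
            have e1 : (13.782118 * Y - 73.832775) / L
                = 0.984437 * (2 * Y - 3) / L + 0.984437 * (2 * Y - 5) / L + 0.984437 * (2 * Y - 7) / L + 0.984437 * (2 * Y - 11) / L + 0.984437 * (2 * Y - 13) / L + 0.984437 * (2 * Y - 17) / L + 0.984437 * (2 * Y - 19) / L := by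
              field_simp
              ring
            have e2 : 4 * (11.84 * 1 * (2 * Y) / L ^ 2) + 3 * (11.84 * 1 * (2 * Y) / L ^ 2)
                + 4 * (11.84 * 2 * (2 * Y) / L ^ 2) + 3 * (11.84 * 1 * (2 * Y) / L ^ 2)
                + 2 * (11.84 * (4 / 3) * (2 * Y) / L ^ 2) + 2 * (11.84 * 2 * (2 * Y) / L ^ 2)
                + 2 * (11.84 * (6 / 5) * (2 * Y) / L ^ 2) + 11.84 * 1 * (2 * Y) / L ^ 2
                = (249232 / 375) * Y / L ^ 2 := by
              field_simp
              ring
            have e3 : (249232 / 375 : ℝ) * Y / L ^ 2 ≤ 664.7 * Y / L ^ 2 :=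
              div_le_div_of_nonneg_right (mul_le_mul_of_nonneg_right (by norm_num) hY0) hL2.le
            rw [e1]
            linarith [hcombr, hπ3, hπ5, hπ7, hπ11, hπ13, hπ17, hπ19, hP2, hP4, hP6, hP8, hP10, hP12, hP14, hP16,
              e2, e3]
          have hkey : Y * L ^ 2 ≤ (h : ℝ) * G * L ^ 2 := by
            have e4 : ((13.782118 * Y - 73.832775) / L - 5 - 664.7 * Y / L ^ 2) * L ^ 2
                = 13.782118 * Y * L - 73.832775 * L - 5 * L ^ 2 - 664.7 * Y := by
              field_simp
            have h1 : (13.782118 * Y * L - 73.832775 * L - 5 * L ^ 2 - 664.7 * Y) * h ≤ G * L ^ 2 * h := by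
              rw [← e4]
              exact mul_le_mul_of_nonneg_right (mul_le_mul_of_nonneg_right hG1 hL2.le) hh0.le
            have h2 : Y * (L ^ 2 + h) ≤ Y * (h * (13.782118 * L - 664.7)) :=
              mul_le_mul_of_nonneg_left hq (by linarith)
            have h3 : 73.832775 * L + 5 * L ^ 2 ≤ Y := by
              nlinarith [mul_nonneg (sub_nonneg.2 hL4) hLpos.le]
            have h3' : (h : ℝ) * (73.832775 * L + 5 * L ^ 2) ≤ h * Y := mul_le_mul_of_nonneg_left h3 hh0.le
            nlinarith [h1, h2, h3']
          have hfin := le_of_mul_le_mul_right hkey hL2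
          rw [div_le_iff₀ hh0, mul_comm]
          exact hfin
        · -- TWELVE SHIFTS on `(e^{L₃}, e^{Λ₀})`, pair sieve at the threshold `e^190`
          have hq := hquad12 L hmid3.le hLΛ.le
          have he190 : Real.exp 190 ≤ ((2 * y : ℕ) : ℝ) := by
            have : Real.exp 190 ≤ Real.exp L := Real.exp_le_exp.mpr (hL₃.trans hmid3.le)
            rwa [hLdef, Real.exp_log h2y0] at this
          -- the prime counts above `227·30000^9`: the `m = 68` constant `0.984437` (`ChebyshevCostaPereira68.lean`, shot 9)
          have heS : Real.exp 109 ≤ ((2 * y : ℕ) : ℝ) := by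
            have : Real.exp 109 ≤ Real.exp L := Real.exp_le_exp.mpr (by linarith [hL₃, hmid3])
            rwa [hLdef, Real.exp_log h2y0] at this
          have hNS : 100000000000000000000000000000000000000000000000 ≤ 2 * y := by
            have : ((100000000000000000000000000000000000000000000000 : ℕ) : ℝ) ≤ ((2 * y : ℕ) : ℝ) := by
              have := ten_pow_47_le_exp_109.trans heS; push_cast at this ⊢; linarith
            exact_mod_cast this
          have hπC : ∀ q : ℕ, q ≤ 41 → 0.984437 * (2 * (y : ℝ) - q) / L ≤ (Nat.primeCounting (2 * y - q) : ℝ) := by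
            intro q hq
            have hqr : (q : ℝ) ≤ 41 := by exact_mod_cast hq
            have hnq : ((2 * y - q : ℕ) : ℝ) = 2 * (y : ℝ) - q := cast_two_mul_sub (by omega)
            have h6 : 4468041000000000000000000000000000000000000 ≤ 2 * y - q := by omega
            have hnq0 : (0 : ℝ) < ((2 * y - q : ℕ) : ℝ) := by rw [hnq]; linarith
            have hnq1 : (1 : ℝ) < ((2 * y - q : ℕ) : ℝ) := by rw [hnq]; linarith
            have h1 : 0.984437 * ((2 * y - q : ℕ) : ℝ) / Real.log ((2 * y - q : ℕ) : ℝ)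
                ≤ (Nat.primeCounting (2 * y - q) : ℝ) := Literature.NumberTheory.LFunctions.CostaPereira68.primeCounting_ge_9 h6
            have hlogq0 : 0 < Real.log ((2 * y - q : ℕ) : ℝ) := Real.log_pos hnq1
            have hlogq : Real.log ((2 * y - q : ℕ) : ℝ) ≤ L := by
              have h2y : ((2 * y - q : ℕ) : ℝ) ≤ ((2 * y : ℕ) : ℝ) := by
                rw [hnq]; push_cast; linarith [Nat.cast_nonneg (α := ℝ) q]
              exact Real.log_le_log hnq0 h2y
            have h2 : 0.984437 * (2 * (y : ℝ) - q) / L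
                ≤ 0.984437 * ((2 * y - q : ℕ) : ℝ) / Real.log ((2 * y - q : ℕ) : ℝ) := by
              rw [← hnq]
              exact div_le_div_of_nonneg_left (by positivity) hlogq0 hlogq
            linarith
          have hPt : ∀ d : ℕ, d ≠ 0 → Even d →
              (#((Nat.primesLE (2 * y)).filter (fun p => (p + d).Prime)) : ℝ)
                ≤ 11.52 * oddSingularFactor d * ((2 * y : ℕ) : ℝ) / L ^ 2 := by
            intro d hd hde
            rw [hLdef]
            exact pairCount_le_1152 (N := 2 * y) (h := d) he190 hd hde
          have hQ2 := hPt 2 (by norm_num) (by norm_num)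
          have hQ4 := hPt 4 (by norm_num) (by norm_num)
          have hQ6 := hPt 6 (by norm_num) (by norm_num)
          have hQ8 := hPt 8 (by norm_num) (by norm_num)
          have hQ10 := hPt 10 (by norm_num) (by norm_num)
          have hQ12 := hPt 12 (by norm_num) (by norm_num)
          have hQ14 := hPt 14 (by norm_num) (by norm_num)
          have hQ16 := hPt 16 (by norm_num) (by norm_num)
          have hQ18 := hPt 18 (by norm_num) (by norm_num)
          have hQ20 := hPt 20 (by norm_num) (by norm_num)
          have hQ22 := hPt 22 (by norm_num) (by norm_num)
          have hQ24 := hPt 24 (by norm_num) (by norm_num)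
          have hQ26 := hPt 26 (by norm_num) (by norm_num)
          have hQ28 := hPt 28 (by norm_num) (by norm_num)
          have hQ30 := hPt 30 (by norm_num) (by norm_num)
          have hQ32 := hPt 32 (by norm_num) (by norm_num)
          have hQ34 := hPt 34 (by norm_num) (by norm_num)
          have hQ36 := hPt 36 (by norm_num) (by norm_num)
          have hQ38 := hPt 38 (by norm_num) (by norm_num)
          rw [oddSingularFactor_two'] at hQ2
          rw [oddSingularFactor_four] at hQ4
          rw [oddSingularFactor_six] at hQ6
          rw [oddSingularFactor_eight] at hQ8
          rw [oddSingularFactor_ten] at hQ10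
          rw [oddSingularFactor_twelve] at hQ12
          rw [oddSingularFactor_fourteen] at hQ14
          rw [oddSingularFactor_sixteen] at hQ16
          rw [oddSingularFactor_eighteen] at hQ18
          rw [oddSingularFactor_twenty] at hQ20
          rw [oddSingularFactor_twentytwo] at hQ22
          rw [oddSingularFactor_twentyfour] at hQ24
          rw [oddSingularFactor_twentysix] at hQ26
          rw [oddSingularFactor_twentyeight] at hQ28
          rw [oddSingularFactor_thirty] at hQ30
          rw [oddSingularFactor_thirtytwo] at hQ32
          rw [oddSingularFactor_thirtyfour] at hQ34
          rw [oddSingularFactor_thirtysix] at hQ36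
          rw [oddSingularFactor_thirtyeight] at hQ38
          have hcomb := twelve_shift_count (y := y) (by omega)
          have hcombr : (Nat.primeCounting (2 * y - 3) : ℝ) + Nat.primeCounting (2 * y - 5)
              + Nat.primeCounting (2 * y - 7) + Nat.primeCounting (2 * y - 11) + Nat.primeCounting (2 * y - 13)
              + Nat.primeCounting (2 * y - 17) + Nat.primeCounting (2 * y - 19) + Nat.primeCounting (2 * y - 23)
              + Nat.primeCounting (2 * y - 29) + Nat.primeCounting (2 * y - 31) + Nat.primeCounting (2 * y - 37)
              + Nat.primeCounting (2 * y - 41)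
              ≤ (#{b ∈ Ioc 0 y | b ∈ (({0, 1} : Set ℕ) ∪ {m | ∃ p q : ℕ, p.Prime ∧ q.Prime ∧ p + q = 2 * m})} : ℝ) + 10
                + (5 * #((Nat.primesLE (2 * y)).filter (fun p => (p + 2).Prime))
                  + 5 * #((Nat.primesLE (2 * y)).filter (fun p => (p + 4).Prime))
                  + 7 * #((Nat.primesLE (2 * y)).filter (fun p => (p + 6).Prime))
                  + 5 * #((Nat.primesLE (2 * y)).filter (fun p => (p + 8).Prime))
                  + 5 * #((Nat.primesLE (2 * y)).filter (fun p => (p + 10).Prime))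
                  + 6 * #((Nat.primesLE (2 * y)).filter (fun p => (p + 12).Prime))
                  + 4 * #((Nat.primesLE (2 * y)).filter (fun p => (p + 14).Prime))
                  + 3 * #((Nat.primesLE (2 * y)).filter (fun p => (p + 16).Prime))
                  + 5 * #((Nat.primesLE (2 * y)).filter (fun p => (p + 18).Prime))
                  + 3 * #((Nat.primesLE (2 * y)).filter (fun p => (p + 20).Prime))
                  + 2 * #((Nat.primesLE (2 * y)).filter (fun p => (p + 22).Prime))
                  + 4 * #((Nat.primesLE (2 * y)).filter (fun p => (p + 24).Prime))
                  + 3 * #((Nat.primesLE (2 * y)).filter (fun p => (p + 26).Prime))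
                  + 2 * #((Nat.primesLE (2 * y)).filter (fun p => (p + 28).Prime))
                  + 2 * #((Nat.primesLE (2 * y)).filter (fun p => (p + 30).Prime))
                  + #((Nat.primesLE (2 * y)).filter (fun p => (p + 32).Prime))
                  + 2 * #((Nat.primesLE (2 * y)).filter (fun p => (p + 34).Prime))
                  + #((Nat.primesLE (2 * y)).filter (fun p => (p + 36).Prime))
                  + #((Nat.primesLE (2 * y)).filter (fun p => (p + 38).Prime))) := by
            exact_mod_cast hcomb
          have hπ3 := hπC 3 (by norm_num)
          have hπ5 := hπC 5 (by norm_num)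
          have hπ7 := hπC 7 (by norm_num)
          have hπ11 := hπC 11 (by norm_num)
          have hπ13 := hπC 13 (by norm_num)
          have hπ17 := hπC 17 (by norm_num)
          have hπ19 := hπC 19 (by norm_num)
          have hπ23 := hπC 23 (by norm_num)
          have hπ29 := hπC 29 (by norm_num)
          have hπ31 := hπC 31 (by norm_num)
          have hπ37 := hπC 37 (by norm_num)
          have hπ41 := hπC 41 (by norm_num)
          push_cast at hπ3 hπ5 hπ7 hπ11 hπ13 hπ17 hπ19 hπ23 hπ29 hπ31 hπ37 hπ41
          have h2yr : ((2 * y : ℕ) : ℝ) = 2 * (y : ℝ) := by push_cast; ring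
          rw [h2yr] at hQ2 hQ4 hQ6 hQ8 hQ10 hQ12 hQ14 hQ16 hQ18 hQ20 hQ22 hQ24 hQ26 hQ28 hQ30 hQ32 hQ34 hQ36 hQ38
          set G : ℝ := (#{b ∈ Ioc 0 y | b ∈ (({0, 1} : Set ℕ) ∪ {m | ∃ p q : ℕ, p.Prime ∧ q.Prime ∧ p + q = 2 * m})} : ℝ) with hG
          set Y : ℝ := (y : ℝ) with hY
          have hY0 : 0 ≤ Y := le_trans (by norm_num) hy58
          have hL2 : (0 : ℝ) < L ^ 2 := by positivity
          have hG1 : (23.626488 * Y - 232.327132) / L - 10 - 2233 * Y / L ^ 2 ≤ G := by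
            have e1 : (23.626488 * Y - 232.327132) / L
                = 0.984437 * (2 * Y - 3) / L + 0.984437 * (2 * Y - 5) / L + 0.984437 * (2 * Y - 7) / L + 0.984437 * (2 * Y - 11) / L
                  + 0.984437 * (2 * Y - 13) / L + 0.984437 * (2 * Y - 17) / L + 0.984437 * (2 * Y - 19) / L + 0.984437 * (2 * Y - 23) / L
                  + 0.984437 * (2 * Y - 29) / L + 0.984437 * (2 * Y - 31) / L + 0.984437 * (2 * Y - 37) / L + 0.984437 * (2 * Y - 41) / L := by
              field_simp
              ring
            have e2 : 5 * (11.52 * 1 * (2 * Y) / L ^ 2)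
                + 5 * (11.52 * 1 * (2 * Y) / L ^ 2)
                + 7 * (11.52 * 2 * (2 * Y) / L ^ 2)
                + 5 * (11.52 * 1 * (2 * Y) / L ^ 2)
                + 5 * (11.52 * (4 / 3) * (2 * Y) / L ^ 2)
                + 6 * (11.52 * 2 * (2 * Y) / L ^ 2)
                + 4 * (11.52 * (6 / 5) * (2 * Y) / L ^ 2)
                + 3 * (11.52 * 1 * (2 * Y) / L ^ 2)
                + 5 * (11.52 * 2 * (2 * Y) / L ^ 2)
                + 3 * (11.52 * (4 / 3) * (2 * Y) / L ^ 2)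
                + 2 * (11.52 * (10 / 9) * (2 * Y) / L ^ 2)
                + 4 * (11.52 * 2 * (2 * Y) / L ^ 2)
                + 3 * (11.52 * (12 / 11) * (2 * Y) / L ^ 2)
                + 2 * (11.52 * (6 / 5) * (2 * Y) / L ^ 2)
                + 2 * (11.52 * (8 / 3) * (2 * Y) / L ^ 2)
                + 11.52 * 1 * (2 * Y) / L ^ 2
                + 2 * (11.52 * (16 / 15) * (2 * Y) / L ^ 2)
                + 11.52 * 2 * (2 * Y) / L ^ 2
                + 11.52 * (18 / 17) * (2 * Y) / L ^ 2
                = (93923136 / 42075) * Y / L ^ 2 := by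
              field_simp
              ring
            have e3 : (93923136 / 42075 : ℝ) * Y / L ^ 2 ≤ 2233 * Y / L ^ 2 :=
              div_le_div_of_nonneg_right (mul_le_mul_of_nonneg_right (by norm_num) hY0) hL2.le
            rw [e1]
            linarith [hcombr, hπ3, hπ5, hπ7, hπ11, hπ13, hπ17, hπ19, hπ23, hπ29, hπ31, hπ37, hπ41,
              hQ2, hQ4, hQ6, hQ8, hQ10, hQ12, hQ14, hQ16, hQ18, hQ20, hQ22, hQ24, hQ26, hQ28, hQ30, hQ32, hQ34, hQ36, hQ38, e2, e3]
          have hkey : Y * L ^ 2 ≤ (h : ℝ) * G * L ^ 2 := by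
            have e4 : ((23.626488 * Y - 232.327132) / L - 10 - 2233 * Y / L ^ 2) * L ^ 2
                = 23.626488 * Y * L - 232.327132 * L - 10 * L ^ 2 - 2233 * Y := by
              field_simp
            have h1 : (23.626488 * Y * L - 232.327132 * L - 10 * L ^ 2 - 2233 * Y) * h ≤ G * L ^ 2 * h := by
              rw [← e4]
              exact mul_le_mul_of_nonneg_right (mul_le_mul_of_nonneg_right hG1 hL2.le) hh0.le
            have h2 : Y * (L ^ 2 + h) ≤ Y * (h * (23.626488 * L - 2233)) :=
              mul_le_mul_of_nonneg_left hq (by linarith)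
            have h3 : 232.327132 * L + 10 * L ^ 2 ≤ Y := by
              nlinarith [mul_nonneg (sub_nonneg.2 hL4) hLpos.le]
            have h3' : (h : ℝ) * (232.327132 * L + 10 * L ^ 2) ≤ h * Y := mul_le_mul_of_nonneg_left h3 hh0.le
            nlinarith [h1, h2, h3']
          have hfin := le_of_mul_le_mul_right hkey hL2
          rw [div_le_iff₀ hh0, mul_comm]
          exact hfin


/-! ### §28.3 Instances: the count `x/38` above `e^313`, the unconditional glue with `h = 19`, density `1/19`, Mann: `K ≤ 39` -/

/-- **Unconditional, above `e^313`**: at least `x/38` EVEN Goldbach numbers in `(0, x]` (`J = 400` levels, gap 16;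
`Λs = 297`, `A = 11.35` from the `c = 16` sieve on the 68 cells with the harmonic constant, `c₁ = 0.4845 = 0.984437²/2`
(`ChebyshevCostaPereira68.lean` shot 9); `(1/38)⁷·259.55·11.35⁸ = 0.6245 ≤ (0.4844·gHol4 313 − 0.00005)⁸ = 0.6724`). [cite: Nathanson1996, Theorem 7.8 (proof, restricted to even N; explicit form `x/38` above `e^313` proved here)] -/
theorem goldbach_even_count_ge_38_exp313 {x : ℕ} (hx : Real.exp 313 ≤ (x : ℝ)) :
    (x : ℝ) / 38 ≤ #{N ∈ Ioc 0 x | Even N ∧ ∃ p q : ℕ, p.Prime ∧ q.Prime ∧ p + q = N} := by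
  have h := goldbach_even_count_ge_holder400g (Λs := 297) (Λ₀ := 313) (A := 11.35) (c₁ := 0.4845) (κ := 1 / 38)
    (by norm_num) (by norm_num) (by norm_num) (by norm_num) (by norm_num)
    (fun N hN hev => goldbachCount_le_1135 hN hev) (by norm_num) (by norm_num)
    (fun y hy => sum_goldbachCount_ge_04845 ((Real.exp_le_exp.mpr (by norm_num)).trans hy))
    (by unfold gHol4; norm_num) (by unfold gHol4; norm_num) hx
  have e : (1 : ℝ) / 38 * x = x / 38 := by ring
  rw [e] at h
  exact h

/-- **Unconditional count for all `y ≥ 1`**: `B(y) ≥ y/19` (one shift below `e^{37.29} ≤ e^{1.96266·19}`, three shifts on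
`[37.29, 47.4]` (pair sieve `13.05` from `e^{37.29}`, counts `0.98133`), four on `[47.4, 109]` (counts `0.982815`), seven on
`[109, 190]` (`11.84`, counts `0.984437`), twelve on `[190, 313]` (`11.52`), the count `x/38` above `e^313`;
windows `(15.66, 96.21)`, `(28.99, 120.40)`, `(63.89, 197.97)`, `(135.39, 313.52)`). [cite: Nathanson1996, Theorem 7.8 (explicit constant `1/19` for the halved set proved here)] -/
theorem half_count_ge_allN_19 {y : ℕ} (hy : 1 ≤ y) :
    (y : ℝ) / 19 ≤ #{b ∈ Ioc 0 y | b ∈ (({0, 1} : Set ℕ) ∪ {m | ∃ p q : ℕ, p.Prime ∧ q.Prime ∧ p + q = 2 * m})} := by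
  have h := half_count_ge_allN_cp37 (L₁ := 37.29) (Lt := 47.4) (L₂ := 109) (L₃ := 190) (Λ₀ := 313) (h := 19)
    (by norm_num) (by norm_num) (by norm_num) (by norm_num) (by norm_num) (by norm_num) (by norm_num)
    (fun L h1 h2 => by
      push_cast
      nlinarith [mul_nonneg (sub_nonneg.2 h1) (sub_nonneg.2 h2)])
    (fun L h1 h2 => by
      push_cast
      nlinarith [mul_nonneg (sub_nonneg.2 h1) (sub_nonneg.2 h2)])
    (fun L h1 h2 => by
      push_cast
      nlinarith [mul_nonneg (sub_nonneg.2 h1) (sub_nonneg.2 h2)])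
    (fun L h1 h2 => by
      push_cast
      nlinarith [mul_nonneg (sub_nonneg.2 h1) (sub_nonneg.2 h2)])
    (fun x hx => by
      have h1 := goldbach_even_count_ge_38_exp313 hx
      have e : (x : ℝ) / (2 * ((19 : ℕ) : ℝ)) = (x : ℝ) / 38 := by norm_num
      rw [e]
      exact h1) hy
  exact_mod_cast h

/-- **The halved density, `1/19`**: `σ({0, 1} ∪ {m : 2m = p + q}) ≥ 1/19`, unconditionally. [cite: Nathanson1996, Theorem 7.8 (explicit constant `1/19` for the halved set proved here)] -/
theorem schnirelmannDensity_half_ge_19 :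
    (1 : ℝ) / 19 ≤ schnirelmannDensity
      (({0, 1} : Set ℕ) ∪ {m | ∃ p q : ℕ, p.Prime ∧ q.Prime ∧ p + q = 2 * m}) := by
  have h := schnirelmannDensity_ge_of_count' (K := 19)
    (S := ({0, 1} : Set ℕ) ∪ {m | ∃ p q : ℕ, p.Prime ∧ q.Prime ∧ p + q = 2 * m})
    (fun N hN => by have := half_count_ge_allN_19 hN; exact_mod_cast this)
  exact_mod_cast h

/-- ★★★★★★★★★★★★★★★★★★★★ **UNCONDITIONAL: every integer `N ≥ 2` is a sum of at most `39` primes** (ROUND-44 «CP-m»: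
a NEW Costa-Pereira-type elementary Chebyshev scheme with `m = 68` (`ν = μ` below 68, `ν(78) = −1`, `ν(86) = 1`,
`ν(10127) = −1`, five far divisors of `67#` balancing `Σ ν(k)/k = 0` exactly; `F = Σ ν(k)⌊y/k⌋` certified in the kernel
on `[1, 30000)`, `|F| ≤ 23` beyond; ten non-inductive comparison shots from the `m = 17` constants) gives
`ψ(x) ≥ 0.98133·x` (`x ≥ e^{36.35}`), `≥ 0.982815·x` (`x ≥ e^{46.66}`), `≥ 0.984437·x` (`x ≥ e^{98.21}`); these replace
`0.9636` regime by regime in the count side of ROUND-43's glue (pair sieve re-derived from `e^{37.29}`): one shift then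
reaches `1.96266·19 ≥ 37.29`, count `x/38` above `e^313`, `h = 19`, Mann `2·19 + 1`).  ZERO named facts.
(ROUND-43: `41`; ROUND-42: `43`; ROUND-40/41: `45`.)
[cite: Nathanson1996, Thm 7.9 (Shnirel'man–Goldbach; explicit constant proved here)] -/
theorem schnirelmann_goldbach_le_39 (N : ℕ) (hN : 2 ≤ N) :
    ∃ M : Multiset ℕ, (∀ p ∈ M, p.Prime) ∧ Multiset.card M ≤ 39 ∧ M.sum = N := by
  have hσ : (1 : ℝ) / ((19 : ℕ) : ℝ) ≤ schnirelmannDensity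
      (({0, 1} : Set ℕ) ∪ {m | ∃ p q : ℕ, p.Prime ∧ q.Prime ∧ p + q = 2 * m}) := by
    have := schnirelmannDensity_half_ge_19
    exact_mod_cast this
  exact sum_of_primes_of_half_density_mann (h := 19) (by norm_num) hσ N hN

end Literature.NumberTheory.Sieve.ShnirelmanGoldbachExplicit
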